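import Literature.NumberTheory.LFunctions.ZetaZeroReciprocalSum
import Literature.NumberTheory.LFunctions.RieszMeanPerron
import Mathlib.Analysis.SpecialFunctions.JapaneseBracket
import HarnessLib

/-!
# The explicit formula for `ψ₁(x) = ∑_{n ≤ x} Λ(n)(x − n)` (de la Vallée Poussin 1896)

Topic: `Literature/NumberTheory/LFunctions`. THEOREM (everything proved): the Riemann–von Mangoldt
explicit formula for the Riesz mean of order one of the von Mangoldt function,

  **`ψ₁(x) = x²/2 − ∑_ρ m(ρ) x^{ρ+1}/(ρ(ρ+1)) − (log 2π) x + E(x)`**,   `x ≥ 1`,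

the sum over the non-trivial zeros `ρ` of `ζ` (with multiplicity `m(ρ)`) converging absolutely, and
the remainder being the absolutely convergent line integral
`E(x) = (1/2πi) ∫_{(−1/2)} x^{s+1} (−ζ'/ζ(s)) ds/(s(s+1)) = O(x^{1/2})`
(Montgomery–Vaughan, *Multiplicative Number Theory I*, (13.7): "`ψ₁(x) = x²/2 − ∑_ρ x^{ρ+1}/(ρ(ρ+1))
− (ζ'/ζ)(0) x + (ζ'/ζ)(−1) + O(x^{−1/2})`"; §12.1.1 Exercise 6 (de la Vallée Poussin 1896) for the
exact evaluation `E(x) = (ζ'/ζ)(−1) − ∑_{k ≥ 1} x^{1−2k}/(2k(2k−1))`, which we do not need and do not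
prove here; `(ζ'/ζ)(0) = log 2π`, Mathlib's `deriv_riemannZeta_zero`, `riemannZeta_zero`).

This is the absolutely convergent explicit formula from which Nicolas (1983, Prop. 1; 2012,
Lemma 2.5) derives `J(x) = −∑_ρ (1/ρ) F_ρ(x) − J₁(x)` for
`J(x) = ∫_x^∞ (ψ(t) − t) t^{-2} (1/log t + 1/log² t) dt`, the explicit-formula input of the
RH-explicit Mertens bound `Nicolas2012_logf_lower_sharp` (`NicolasMertensRH.lean`) behind Robin's and
Lagarias's criteria.

**Proof** (MV §12.1 with the Riesz kernel, §5.1). Start from Perron's formula of order one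
(`Literature.NumberTheory.LFunctions.rieszMean_vonMangoldt_eq_integral`, the tree; absolutely convergent):
`ψ₁(x) = (1/2πi) ∫_{(3/2)} (−ζ'/ζ(s)) x^{s+1} ds/(s(s+1))`, and integrate
`G(s) = (−ζ'/ζ(s)) k(s)`, `k(s) = x^{s+1}/(s(s+1))`, over the boundary of `[−1/2, 3/2] × [−T, T]` at
the good heights `T = T_N` of `ZetaZeroReciprocalSum.lean` (`exists_goodHeight_log`). Writing
`−ζ'/ζ = −ζ₁'/ζ₁ + 1/(s−1)` (`ζ₁ = (s−1)ζ`, entire), the residues are obtained from the weighted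
argument principle for `ζ₁` on the two outer strips `δ ≤ |Im s| ≤ T` (zeros: `−∑ m(ρ) k(ρ)`), from
Cauchy's formula on the zero-free middle strip `|Im s| ≤ δ` (pole of `k` at `0`:
`−(ζ₁'/ζ₁)(0)·x = −(log 2π − 1) x`), and from the partial fractions of
`k(s)/(s−1) = x^{s+1}(½/(s−1) − 1/s + ½/(s+1))` (`x²/2 − x`): altogether
`∮ G = 2πi (x²/2 − ∑_{|Im ρ| < T} m(ρ)k(ρ) − x log 2π)` (`contour_identity_psiOne`). On the boundary
`|ζ'/ζ(σ ± iT)| ≪ log² T` (`ζ'/ζ = ξ'/ξ − 1/s − 1/(s−1) − Γ_ℝ'/Γ_ℝ`, valid on `Re s > −1`, `s ≠ 0`: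
`logDeriv_riemannZeta_eq_logDeriv_riemannXi`; the tree's bound for `ξ'/ξ` at good heights and the
digamma bound with one backward step `ψ(w) = ψ(w+1) − 1/w`), `|k| ≤ x^{5/2}/T²`, so the horizontal
sides tend to `0`; the right side tends to `2πi ψ₁(x)` and the left side to `2πi E(x)`, where on
`Re s = −1/2` one has `|ζ'/ζ| ≤ C + 2 log(1+|t|)` (`norm_logDeriv_riemannZeta_left_le`) against
`|k| = √x/(¼ + t²)`.

Main results:
* `Literature.NumberTheory.LFunctions.psiOne`, `Literature.NumberTheory.LFunctions.psiOneRemainder` (`E(x)`);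
* `Literature.NumberTheory.LFunctions.summable_norm_psiOne_zeroTerm` — absolute convergence of `∑_ρ m(ρ) x^{ρ+1}/(ρ(ρ+1))`;
* `Literature.NumberTheory.LFunctions.psiOne_eq_explicit` — the formula above, `x ≥ 1`;
* `Literature.NumberTheory.LFunctions.exists_norm_psiOneRemainder_le` — `|E(x)| ≤ C √x` for `x > 0`;
* `Literature.NumberTheory.LFunctions.norm_psiOne_zeroSum_le_of_RH` — under RH `|∑_ρ m(ρ) x^{ρ+1}/(ρ(ρ+1))| ≤ β x^{3/2}`
  (`β = nicolasBeta`, by `ZetaZeroReciprocalSum.lean`), whence MV (13.8) in the explicit form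
  `|ψ₁(x) − x²/2 + (log 2π)x − E(x)| ≤ β x^{3/2}` (`Literature.NumberTheory.LFunctions.norm_psiOne_sub_le_of_RH`).
* Tools of independent use (namespace `Literature.RH.PsiOneExplicit`): `ζ'/ζ = ξ'/ξ − 1/s − 1/(s−1) −
  Γ_ℝ'/Γ_ℝ` on `Re s > −1` (`logDeriv_riemannZeta_eq_logDeriv_riemannXi`), the bounds
  `exists_norm_logDeriv_riemannZeta_horizontal_le` (good heights, `σ ∈ [−1/2, 3/2]`) and
  `exists_norm_logDeriv_riemannZeta_left_le` (the line `−1/2`), `logDeriv_riemannZeta₁_zero`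
  (`ζ₁'/ζ₁(0) = log 2π − 1`).

## References

* H. L. Montgomery, R. C. Vaughan, *Multiplicative Number Theory I*, CUP 2007, §5.1 (5.19)–(5.20),
  §12.1 and §12.1.1 Exercise 6, §13.1 (13.6)–(13.8). [MontgomeryVaughan2007]
* C.-J. de la Vallée Poussin, *Recherches analytiques sur la théorie des nombres premiers*, Ann.
  Soc. Sci. Bruxelles 20 (1896). [Poussin1896]
* J.-L. Nicolas, Acta Arith. 155 (2012), Lemma 2.5. [Nicolas2012]
-/

noncomputable section

open Complex Filter Set MeasureTheory Topology intervalIntegral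
open scoped Real ComplexConjugate

namespace Literature.NumberTheory.LFunctions

/-! ### `ψ₁` and the kernel -/

/-- The Riesz mean of order one of `Λ`: `ψ₁(x) = ∑_{n ≤ x} Λ(n)(x − n) = ∫₀ˣ ψ(u) du`
(Montgomery–Vaughan (13.6)). [cite: MontgomeryVaughan2007, (13.6)] -/
def psiOne (x : ℝ) : ℝ := ∑ n ∈ Finset.Ioc 0 ⌊x⌋₊, (ArithmeticFunction.vonMangoldt n : ℝ) * (x - n)

namespace PsiOneExplicit

/-- The Riesz kernel of order one, `k_x(s) = x^{s+1}/(s(s+1))`. [cite: MontgomeryVaughan2007, §5.1 (5.19)] -/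
def kernel (x : ℝ) (s : ℂ) : ℂ := (x : ℂ) ^ (s + 1) / (s * (s + 1))

/-- The contour integrand `G_x(s) = (−ζ'/ζ(s)) · k_x(s)`, written exactly as in
`Literature.NumberTheory.LFunctions.rieszMean_vonMangoldt_eq_integral`. [cite: MontgomeryVaughan2007, §5.1 (5.20)] -/
def integrand (x : ℝ) (s : ℂ) : ℂ :=
  (x : ℂ) ^ (1 + s) * (-deriv riemannZeta s / riemannZeta s) * (1 / (s * (s + 1)))

/-- `G_x = (−ζ'/ζ) · k_x`. [folklore] -/
theorem integrand_eq (x : ℝ) (s : ℂ) :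
    integrand x s = (-deriv riemannZeta s / riemannZeta s) * kernel x s := by
  simp only [integrand, kernel, add_comm (1 : ℂ) s]
  ring

/-- `‖x^{s+1}‖ = x^{Re s + 1}` for `x > 0`. [folklore] -/
theorem norm_cpow_add_one {x : ℝ} (hx : 0 < x) (s : ℂ) :
    ‖(x : ℂ) ^ (s + 1)‖ = x ^ (s.re + 1) := by
  rw [Complex.norm_cpow_eq_rpow_re_of_pos hx]
  simp

/-- `‖k_x(s)‖ = x^{Re s+1}/(‖s‖ ‖s+1‖)`. [folklore] -/
theorem norm_kernel {x : ℝ} (hx : 0 < x) (s : ℂ) :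
    ‖kernel x s‖ = x ^ (s.re + 1) / (‖s‖ * ‖s + 1‖) := by
  rw [kernel, norm_div, norm_cpow_add_one hx, norm_mul]

/-- `s ↦ x^{s+1}` is entire (`x > 0`). [folklore] -/
theorem differentiable_cpow_add_one {x : ℝ} (hx : 0 < x) :
    Differentiable ℂ fun s : ℂ ↦ (x : ℂ) ^ (s + 1) := fun s ↦
  (differentiableAt_id.add_const 1).const_cpow (Or.inl (by exact_mod_cast hx.ne'))

/-- `k_x` is analytic off `{0, −1}` (`x > 0`). [folklore] -/
theorem analyticAt_kernel {x : ℝ} (hx : 0 < x) {s : ℂ} (h0 : s ≠ 0) (h1 : s ≠ -1) :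
    AnalyticAt ℂ (kernel x) s := by
  unfold kernel
  refine ((differentiable_cpow_add_one hx).analyticAt s).div
    (analyticAt_id.mul (analyticAt_id.add analyticAt_const)) ?_
  exact mul_ne_zero h0 (fun h ↦ h1 (by linear_combination h))

/-- Off the real axis `k_x` is analytic. [folklore] -/
theorem analyticAt_kernel_of_im_ne_zero {x : ℝ} (hx : 0 < x) {s : ℂ} (h : s.im ≠ 0) :
    AnalyticAt ℂ (kernel x) s :=
  analyticAt_kernel hx (fun h0 ↦ h (by simp [h0])) (fun h1 ↦ h (by simp [h1]))

/-! ### `ζ'/ζ` through `ξ'/ξ` on `Re s > −1` -/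

/-- `ξ(s) = (s/2) Γ_ℝ(s) ζ₁(s)` for `Re s > −1`, `s ≠ 0` (extends the tree's
`riemannXi_eq_mul_of_re_pos`; the only pole of `Γ_ℝ` with `Re > −1` is `0`). [cite: Titchmarsh1986, §2.1] -/
theorem riemannXi_eq_mul_of_neg_one_lt_re {s : ℂ} (hs : -1 < s.re) (h0 : s ≠ 0) :
    riemannXi s = s / 2 * Gammaℝ s * riemannZeta₁ s := by
  by_cases h1 : s = 1
  · subst h1
    rw [riemannXi_one, Gammaℝ_one, riemannZeta₁_one]
    norm_num
  have hG : Gammaℝ s ≠ 0 := by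
    rw [Ne, Gammaℝ_eq_zero_iff]
    rintro ⟨n, hn⟩
    have := congrArg Complex.re hn
    simp at this
    rcases Nat.eq_zero_or_pos n with hn0 | hn0
    · subst hn0; simp at hn; exact h0 hn
    · have : (1 : ℝ) ≤ n := by exact_mod_cast hn0
      linarith
  have hΛ : completedRiemannZeta s = Gammaℝ s * riemannZeta s := by
    rw [riemannZeta_def_of_ne_zero h0]
    field_simp
  rw [riemannXi_eq_mul_completedRiemannZeta h0 h1, hΛ, riemannZeta₁_eq_mul h1]
  ring

/-- `ξ'/ξ = 1/s + Γ_ℝ'/Γ_ℝ + ζ₁'/ζ₁` at every `s` with `Re s > −1`, `s ≠ 0`, `ζ₁(s) ≠ 0`. [folklore] -/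
theorem logDeriv_riemannXi_eq_of_neg_one_lt_re {s : ℂ} (hs : -1 < s.re) (h0 : s ≠ 0)
    (hζ : riemannZeta₁ s ≠ 0) :
    logDeriv riemannXi s = 1 / s + logDeriv Gammaℝ s + logDeriv riemannZeta₁ s := by
  have hU : IsOpen {z : ℂ | -1 < z.re ∧ z ≠ 0} :=
    (isOpen_lt continuous_const Complex.continuous_re).inter isOpen_ne
  have hev : riemannXi =ᶠ[𝓝 s] fun z ↦ z / 2 * Gammaℝ z * riemannZeta₁ z := by
    filter_upwards [hU.mem_nhds ⟨hs, h0⟩] with z hz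
    exact riemannXi_eq_mul_of_neg_one_lt_re hz.1 hz.2
  have h1 : logDeriv riemannXi s = logDeriv (fun z ↦ z / 2 * Gammaℝ z * riemannZeta₁ z) s := by
    rw [logDeriv_apply, logDeriv_apply, hev.deriv_eq, hev.eq_of_nhds]
  have hs2 : s / 2 ≠ 0 := div_ne_zero h0 two_ne_zero
  have hpole : ∀ m : ℕ, s / 2 ≠ -m := by
    intro m h
    have := congrArg Complex.re h
    simp at this
    rcases Nat.eq_zero_or_pos m with hm | hm
    · subst hm; simp at h; exact h0 h
    · have : (1 : ℝ) ≤ m := by exact_mod_cast hm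
      linarith
  have hG : Gammaℝ s ≠ 0 := by
    rw [Ne, Gammaℝ_eq_zero_iff]
    rintro ⟨n, hn⟩
    exact hpole n (by rw [hn]; ring)
  have hdG : DifferentiableAt ℂ Gammaℝ s := (RealZeros.hasDerivAt_Gammaℝ hpole).differentiableAt
  have hd2 : DifferentiableAt ℂ (fun z : ℂ ↦ z / 2) s := differentiableAt_id.div_const 2
  rw [h1, logDeriv_mul (f := fun z ↦ z / 2 * Gammaℝ z) (g := riemannZeta₁) s
      (mul_ne_zero hs2 hG) hζ (hd2.mul hdG) (differentiable_riemannZeta₁ s),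
    logDeriv_mul (f := fun z : ℂ ↦ z / 2) (g := Gammaℝ) s hs2 hG hd2 hdG]
  have : logDeriv (fun z : ℂ ↦ z / 2) s = 1 / s := by
    rw [logDeriv_apply, deriv_div_const, deriv_id'']
    field_simp
  rw [this]

/-- **`ζ'/ζ = ξ'/ξ − 1/s − 1/(s−1) − Γ_ℝ'/Γ_ℝ`** at `s` with `Re s > −1`, `s ≠ 0, 1`, `ζ(s) ≠ 0`.
[folklore] -/
theorem logDeriv_riemannZeta_eq_logDeriv_riemannXi {s : ℂ} (hs : -1 < s.re) (h0 : s ≠ 0)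
    (h1 : s ≠ 1) (hζ : riemannZeta s ≠ 0) :
    deriv riemannZeta s / riemannZeta s =
      logDeriv riemannXi s - 1 / s - 1 / (s - 1) - logDeriv Gammaℝ s := by
  have hζ₁ : riemannZeta₁ s ≠ 0 := by
    rw [riemannZeta₁_eq_mul h1]; exact mul_ne_zero (sub_ne_zero.2 h1) hζ
  rw [← logDeriv_apply, logDeriv_riemannZeta_eq h1 hζ,
    logDeriv_riemannXi_eq_of_neg_one_lt_re hs h0 hζ₁]
  simp only [one_div]
  ring

/-! ### Bounds for `Γ_ℝ'/Γ_ℝ` and `ζ'/ζ` -/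

/-- `Γ_ℝ'/Γ_ℝ(s) = −½ log π + ½ ψ(s/2 + 1) − 1/s` for `Re s > −1`, `s ≠ 0` (one backward step of
`ψ(w+1) = ψ(w) + 1/w`). [folklore] -/
theorem logDeriv_Gammaℝ_eq_shift {s : ℂ} (hs : -1 < s.re) (h0 : s ≠ 0) :
    logDeriv Gammaℝ s = -(Complex.log π) / 2 + digamma (s / 2 + 1) / 2 - 1 / s := by
  have hpole : ∀ m : ℕ, s / 2 ≠ -m := by
    intro m h
    have := congrArg Complex.re h
    simp at this
    rcases Nat.eq_zero_or_pos m with hm | hm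
    · subst hm; simp at h; exact h0 h
    · have : (1 : ℝ) ≤ m := by exact_mod_cast hm
      linarith
  rw [logDeriv_Gammaℝ hpole, Complex.digamma_apply_add_one (s / 2) hpole]
  field_simp
  ring

/-- **`|Γ_ℝ'/Γ_ℝ(σ + it)| ≤ log(|t|+4)/2 + 6`** for `−1/2 ≤ σ ≤ 2`, `|t| ≥ 2`. [folklore] -/
theorem norm_logDeriv_Gammaℝ_le' {σ t : ℝ} (hσ1 : -(1 / 2) ≤ σ) (hσ2 : σ ≤ 2) (ht : 2 ≤ |t|) :
    ‖logDeriv Gammaℝ (σ + t * I)‖ ≤ Real.log (|t| + 4) / 2 + 6 := by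
  set s : ℂ := σ + t * I with hs
  have hsre : s.re = σ := by simp [hs]
  have hsim : s.im = t := by simp [hs]
  have h0 : s ≠ 0 := fun h ↦ by
    have := congrArg Complex.im h; rw [hsim] at this; simp at this; rw [this] at ht; norm_num at ht
  rw [logDeriv_Gammaℝ_eq_shift (by rw [hsre]; linarith) h0, ← Complex.ofReal_log Real.pi_pos.le]
  set w : ℂ := s / 2 + 1 with hw
  have hwre : 0 < w.re := by simp [hw, hsre]; linarith
  have hwim : 1 / 2 ≤ |w.im| := by
    have : w.im = t / 2 := by simp [hw, hsim]
    rw [this, abs_div, abs_two]; linarith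
  have hψ := Literature.Analysis.SpecialFunctions.Complex.norm_digamma_le_log hwre hwim
  have hwn : ‖w‖ ≤ |t| + 3 := by
    have h1 : ‖s‖ ≤ |σ| + |t| := by
      simpa [hs] using Complex.norm_le_abs_re_add_abs_im s
    have hσ' : |σ| ≤ 2 := abs_le.2 ⟨by linarith, hσ2⟩
    calc ‖w‖ ≤ ‖s / 2‖ + ‖(1 : ℂ)‖ := norm_add_le _ _
      _ = ‖s‖ / 2 + 1 := by simp
      _ ≤ |t| + 3 := by linarith [abs_nonneg t]
  have hlog : Real.log (1 + ‖w‖) ≤ Real.log (|t| + 4) :=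
    Real.log_le_log (by positivity) (by linarith)
  have hπ : ‖(-(Real.log π : ℂ)) / 2‖ ≤ 1 := by
    rw [norm_div, norm_neg, Complex.norm_real, Real.norm_eq_abs, Complex.norm_two,
      abs_of_pos (Real.log_pos (by linarith [Real.pi_gt_three]))]
    linarith [log_pi_lt_two]
  have h1s : ‖1 / s‖ ≤ 1 / 2 := by
    rw [norm_div, norm_one]
    have : (2 : ℝ) ≤ ‖s‖ := ht.trans (by rw [← hsim]; exact Complex.abs_im_le_norm s)
    exact one_div_le_one_div_of_le two_pos this
  calc ‖-(Real.log π : ℂ) / 2 + digamma w / 2 - 1 / s‖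
      ≤ ‖-(Real.log π : ℂ) / 2 + digamma w / 2‖ + ‖1 / s‖ := norm_sub_le _ _
    _ ≤ ‖-(Real.log π : ℂ) / 2‖ + ‖digamma w / 2‖ + ‖1 / s‖ := by gcongr; exact norm_add_le _ _
    _ ≤ 1 + (Real.log (|t| + 4) + 8) / 2 + 1 / 2 := by
        gcongr
        rw [norm_div, Complex.norm_two]
        linarith
    _ ≤ Real.log (|t| + 4) / 2 + 6 := by linarith

/-- **`ζ'/ζ` on the horizontal sides at a good height**: there is `C` such that for `|t| ≥ 2`,
`0 < η ≤ 1`, all non-trivial zeros `η`-away from the ordinate `t`, and `σ ∈ [−1/2, 3/2]`,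
`|ζ'/ζ(σ+it)| ≤ C log(|t|+4)/η` (from the tree's `exists_norm_logDeriv_riemannXi_le` and
`ζ'/ζ = ξ'/ξ − 1/s − 1/(s−1) − Γ_ℝ'/Γ_ℝ`). [cite: MontgomeryVaughan2007, Lemma 12.2] -/
theorem exists_norm_logDeriv_riemannZeta_horizontal_le :
    ∃ C : ℝ, 0 < C ∧ ∀ (t η : ℝ), 2 ≤ |t| → 0 < η → η ≤ 1 →
      (∀ ρ ∈ RHWave0.riemannZetaNontrivialZeros, η ≤ |ρ.im - t|) →
      ∀ σ : ℝ, σ ∈ Icc (-(1 / 2) : ℝ) (3 / 2) →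
        ‖deriv riemannZeta (σ + t * I) / riemannZeta (σ + t * I)‖ ≤ C * Real.log (|t| + 4) / η := by
  obtain ⟨C₀, hC₀, h₀⟩ := exists_norm_logDeriv_riemannXi_le
  refine ⟨C₀ + 8, by positivity, fun t η ht hη hη1 hZ σ hσ ↦ ?_⟩
  set s : ℂ := σ + t * I with hs
  have hsre : s.re = σ := by simp [hs]
  have hsim : s.im = t := by simp [hs]
  have ht0 : t ≠ 0 := fun h ↦ by rw [h] at ht; norm_num at ht
  have h0 : s ≠ 0 := fun h ↦ ht0 (by simpa [hsim] using congrArg Complex.im h)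
  have h1 : s ≠ 1 := fun h ↦ ht0 (by simpa [hsim] using congrArg Complex.im h)
  have hζ : riemannZeta s ≠ 0 := by
    intro hz
    have hmem : s ∈ RHWave0.riemannZetaNontrivialZeros :=
      ZetaZeros.riemannZetaNontrivialZeros.mem_of_im_ne_zero hz (by rwa [hsim])
    have := hZ s hmem
    rw [hsim, sub_self, abs_zero] at this
    linarith
  have hZ' : ∀ ρ : ℂ, riemannZeta ρ = 0 → 0 < ρ.re → η ≤ |ρ.im - t| := fun ρ hz h0 ↦
    hZ ρ (ZetaZeros.riemannZetaNontrivialZeros.mem_of_re_pos hz h0)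
  rw [logDeriv_riemannZeta_eq_logDeriv_riemannXi (by rw [hsre]; linarith [hσ.1]) h0 h1 hζ]
  have hL : 1 ≤ Real.log (|t| + 4) := by
    rw [Real.le_log_iff_exp_le (by positivity)]
    linarith [Real.exp_one_lt_d9, abs_nonneg t]
  have hξ := h₀ t η ht hη hη1 hZ' σ hσ
  have hΓ := norm_logDeriv_Gammaℝ_le' (σ := σ) (t := t) (by linarith [hσ.1]) (by linarith [hσ.2]) ht
  have hns : (2 : ℝ) ≤ ‖s‖ := ht.trans (by rw [← hsim]; exact Complex.abs_im_le_norm s)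
  have hns1 : (2 : ℝ) ≤ ‖s - 1‖ := ht.trans (by
    have := Complex.abs_im_le_norm (s - 1); simpa [hsim] using this)
  have h1s : ‖1 / s‖ ≤ 1 / 2 := by
    rw [norm_div, norm_one]; exact one_div_le_one_div_of_le two_pos hns
  have h1s1 : ‖1 / (s - 1)‖ ≤ 1 / 2 := by
    rw [norm_div, norm_one]; exact one_div_le_one_div_of_le two_pos hns1
  set Lg := Real.log (|t| + 4)
  have hLη : Lg ≤ Lg / η := by rw [le_div_iff₀ hη]; nlinarith
  have hη' : 1 ≤ 1 / η := by rw [le_div_iff₀ hη]; linarith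
  calc ‖logDeriv riemannXi s - 1 / s - 1 / (s - 1) - logDeriv Gammaℝ s‖
      ≤ ‖logDeriv riemannXi s‖ + ‖1 / s‖ + ‖1 / (s - 1)‖ + ‖logDeriv Gammaℝ s‖ := by
        refine (norm_sub_le _ _).trans ?_
        gcongr
        refine (norm_sub_le _ _).trans ?_
        gcongr
        exact norm_sub_le _ _
    _ ≤ C₀ * Lg / η + 1 / 2 + 1 / 2 + (Lg / 2 + 6) := by gcongr
    _ ≤ C₀ * Lg / η + 8 * (Lg / η) := by nlinarith
    _ = (C₀ + 8) * Lg / η := by ring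

/-- `ζ(−1/2 + it) ≠ 0` (zeros with `Re s ≤ 0` are the trivial ones `−2, −4, …`). [folklore] -/
theorem riemannZeta_left_ne_zero (t : ℝ) : riemannZeta (((-(1 / 2) : ℝ) : ℂ) + t * I) ≠ 0 := by
  intro hz
  obtain ⟨n, hn⟩ := (riemannZeta_eq_zero_iff_of_re_nonpos (by simp)).1 hz
  have := congrArg Complex.re hn
  simp at this
  linarith [(n.cast_nonneg : (0 : ℝ) ≤ n)]

/-- A bound for `ψ(3/4 + it/2)`, all real `t`: `‖ψ(3/4 + it/2)‖ ≤ 9 + log(1 + |t|)` (logarithmic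
bound for `|t| ≥ 1`, linear bound near the real axis). [folklore] -/
theorem norm_digamma_three_quarters_le (t : ℝ) :
    ‖digamma (((3 / 4 : ℝ) : ℂ) + (t / 2 : ℝ) * I)‖ ≤ 9 + Real.log (1 + |t|) := by
  set w : ℂ := ((3 / 4 : ℝ) : ℂ) + (t / 2 : ℝ) * I with hw
  have hwre : w.re = 3 / 4 := by simp [hw]
  have hwim : w.im = t / 2 := by simp [hw]
  have hlog0 : 0 ≤ Real.log (1 + |t|) := Real.log_nonneg (by linarith [abs_nonneg t])
  rcases le_or_gt 1 |t| with ht | ht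
  · have h := Literature.Analysis.SpecialFunctions.Complex.norm_digamma_le_log (by rw [hwre]; norm_num)
      (by rw [hwim, abs_div, abs_two]; linarith)
    have hwn : ‖w‖ ≤ 1 + |t| := by
      calc ‖w‖ ≤ |w.re| + |w.im| := Complex.norm_le_abs_re_add_abs_im w
        _ = 3 / 4 + |t| / 2 := by
            rw [hwre, hwim, abs_of_pos (by norm_num : (0 : ℝ) < 3 / 4), abs_div, abs_two]
        _ ≤ 1 + |t| := by linarith [abs_nonneg t]
    have hl : Real.log (1 + ‖w‖) ≤ 1 + Real.log (1 + |t|) := by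
      have h2 : Real.log (1 + ‖w‖) ≤ Real.log (2 * (1 + |t|)) :=
        Real.log_le_log (by positivity) (by linarith)
      rw [Real.log_mul (by norm_num) (by positivity)] at h2
      linarith [Real.log_two_lt_d9]
    linarith
  · have h := ZetaZeroSum.norm_digamma_le_linear (w := w) (by rw [hwre])
    have hw1 : ‖w - 1‖ ≤ 1 := by
      calc ‖w - 1‖ ≤ |(w - 1).re| + |(w - 1).im| := Complex.norm_le_abs_re_add_abs_im _
        _ = 1 / 4 + |t| / 2 := by
            simp only [sub_re, one_re, hwre, sub_im, one_im, hwim, sub_zero, abs_div, abs_two]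
            norm_num
        _ ≤ 1 := by linarith
    linarith

/-- **`ζ'/ζ` on the line `Re s = −1/2`**: there is `C` with
`|ζ'/ζ(−1/2 + it)| ≤ C + 2 log(1 + |t|)` for all real `t` (`|ξ'/ξ(−1/2+it)| = |ξ'/ξ(3/2+it)|` by the
functional equation, the tree's bound on the line `3/2`, and
`Γ_ℝ'/Γ_ℝ(−1/2+it) = −½log π + ½ψ(3/4 + it/2) − 1/(−1/2+it)`). [folklore] -/
theorem exists_norm_logDeriv_riemannZeta_left_le :
    ∃ C : ℝ, 0 < C ∧ ∀ t : ℝ,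
      ‖deriv riemannZeta (((-(1 / 2) : ℝ) : ℂ) + t * I) / riemannZeta (((-(1 / 2) : ℝ) : ℂ) + t * I)‖ ≤
        C + 2 * Real.log (1 + |t|) := by
  obtain ⟨Cv, hCv⟩ := exists_norm_logDeriv_riemannXi_vertical_le
  have hCv0 : 0 ≤ Cv := by
    have h := hCv 0
    simp only [abs_zero, add_zero, Real.log_one] at h
    exact (norm_nonneg _).trans h
  refine ⟨Cv + 12, by positivity, fun t ↦ ?_⟩
  set s : ℂ := ((-(1 / 2) : ℝ) : ℂ) + t * I with hs
  have hsre : s.re = -(1 / 2) := by simp [hs]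
  have hsim : s.im = t := by simp [hs]
  have h0 : s ≠ 0 := fun h ↦ by have := congrArg Complex.re h; rw [hsre] at this; norm_num at this
  have h1 : s ≠ 1 := fun h ↦ by have := congrArg Complex.re h; rw [hsre] at this; norm_num at this
  have hζ : riemannZeta s ≠ 0 := riemannZeta_left_ne_zero t
  rw [logDeriv_riemannZeta_eq_logDeriv_riemannXi (by rw [hsre]; norm_num) h0 h1 hζ,
    logDeriv_Gammaℝ_eq_shift (by rw [hsre]; norm_num) h0, ← Complex.ofReal_log Real.pi_pos.le]
  -- `ξ'/ξ` by reflection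
  have hξ : ‖logDeriv riemannXi s‖ ≤ Cv + Real.log (1 + |t|) := by
    rw [hs, norm_logDeriv_riemannXi_reflect, show ((1 - (-(1 / 2)) : ℝ) : ℂ) = ((3 / 2 : ℝ) : ℂ) by
      norm_num]
    exact hCv t
  have hψ : ‖digamma (s / 2 + 1)‖ ≤ 9 + Real.log (1 + |t|) := by
    have e : s / 2 + 1 = ((3 / 4 : ℝ) : ℂ) + (t / 2 : ℝ) * I := by
      rw [hs]; push_cast; ring
    rw [e]; exact norm_digamma_three_quarters_le t
  have hns : (1 / 2 : ℝ) ≤ ‖s‖ := by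
    have := Complex.abs_re_le_norm s; rw [hsre] at this; norm_num at this; exact this
  have hns1 : (3 / 2 : ℝ) ≤ ‖s - 1‖ := by
    have := Complex.abs_re_le_norm (s - 1); simp [hsre] at this; norm_num at this; linarith
  have h1s : ‖1 / s‖ ≤ 2 := by
    rw [norm_div, norm_one, div_le_iff₀ (by linarith)]; linarith
  have h1s1 : ‖1 / (s - 1)‖ ≤ 1 := by
    rw [norm_div, norm_one, div_le_iff₀ (by linarith)]; linarith
  have hπ : ‖(-(Real.log π : ℂ)) / 2‖ ≤ 1 := by
    rw [norm_div, norm_neg, Complex.norm_real, Real.norm_eq_abs, Complex.norm_two,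
      abs_of_pos (Real.log_pos (by linarith [Real.pi_gt_three]))]
    linarith [log_pi_lt_two]
  have hΓ : ‖-(Real.log π : ℂ) / 2 + digamma (s / 2 + 1) / 2 - 1 / s‖ ≤
      8 + Real.log (1 + |t|) / 2 := by
    calc _ ≤ ‖-(Real.log π : ℂ) / 2 + digamma (s / 2 + 1) / 2‖ + ‖1 / s‖ := norm_sub_le _ _
      _ ≤ ‖-(Real.log π : ℂ) / 2‖ + ‖digamma (s / 2 + 1) / 2‖ + ‖1 / s‖ := by
          gcongr; exact norm_add_le _ _
      _ ≤ 1 + (9 + Real.log (1 + |t|)) / 2 + 2 := by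
          gcongr
          rw [norm_div, Complex.norm_two]
          linarith
      _ ≤ _ := by linarith
  calc ‖logDeriv riemannXi s - 1 / s - 1 / (s - 1) -
        (-(Real.log π : ℂ) / 2 + digamma (s / 2 + 1) / 2 - 1 / s)‖
      ≤ ‖logDeriv riemannXi s‖ + ‖1 / s‖ + ‖1 / (s - 1)‖ +
          ‖-(Real.log π : ℂ) / 2 + digamma (s / 2 + 1) / 2 - 1 / s‖ := by
        refine (norm_sub_le _ _).trans ?_
        gcongr
        refine (norm_sub_le _ _).trans ?_
        gcongr
        exact norm_sub_le _ _
    _ ≤ (Cv + Real.log (1 + |t|)) + 2 + 1 + (8 + Real.log (1 + |t|) / 2) := by gcongr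
    _ ≤ Cv + 12 + 2 * Real.log (1 + |t|) := by
        linarith [Real.log_nonneg (by linarith [abs_nonneg t] : (1 : ℝ) ≤ 1 + |t|)]

/-! ### The three strips and the rational piece -/

/-- `ζ₁'/ζ₁` is analytic off the zeros of `ζ₁`. [folklore] -/
theorem analyticAt_logDeriv_riemannZeta₁ {s : ℂ} (hs : riemannZeta₁ s ≠ 0) :
    AnalyticAt ℂ (logDeriv riemannZeta₁) s := by
  have h : logDeriv riemannZeta₁ = fun z ↦ deriv riemannZeta₁ z / riemannZeta₁ z := by
    funext z; rw [logDeriv_apply]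
  rw [h]
  exact (differentiable_riemannZeta₁.analyticAt s).deriv.div
    (differentiable_riemannZeta₁.analyticAt s) hs

/-- **The middle strip** for `ζ₁'/ζ₁ · k_x`: if `−1 < a < 0 < b`, `0 < δ` and `ζ₁` has no zero in
`[a, b] × [−δ, δ]`, then `∮ (ζ₁'/ζ₁) k_x = 2πi · x · ζ₁'/ζ₁(0)` (the only singularity inside is the
simple pole of `k_x` at `0`, of residue `x`; Cauchy's formula for the rectangle). [folklore] -/
theorem rectBoundaryIntegral_middle_zeta₁ {x a b δ : ℝ} (hx : 0 < x) (ha : -1 < a) (ha0 : a < 0)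
    (hb : 0 < b) (hδ : 0 < δ) (hZ : ∀ s : ℂ, s ∈ Icc a b ×ℂ Icc (-δ) δ → riemannZeta₁ s ≠ 0) :
    Literature.Analysis.Complex.rectBoundaryIntegral (fun s ↦ logDeriv riemannZeta₁ s * kernel x s) a b (-δ) δ =
      2 * π * I * ((x : ℂ) * logDeriv riemannZeta₁ 0) := by
  have hab : a ≤ b := by linarith
  have hδδ : -δ ≤ δ := by linarith
  set g : ℂ → ℂ := fun s ↦ logDeriv riemannZeta₁ s * ((x : ℂ) ^ (s + 1) / (s + 1)) with hg
  -- off `0` the integrand is `g(s)/(s - 0)`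
  have hsplit : ∀ s : ℂ, s ≠ 0 → logDeriv riemannZeta₁ s * kernel x s = 1 * (g s / (s - 0)) := by
    intro s h0
    simp only [hg, kernel, sub_zero]
    field_simp
  -- points of the closed strip have `s + 1 ≠ 0`
  have hne1 : ∀ s : ℂ, s ∈ Icc a b ×ℂ Icc (-δ) δ → s + 1 ≠ 0 := by
    intro s hs h
    have h1 : s.re ∈ Icc a b := hs.1
    have : s.re = -1 := by have := congrArg Complex.re h; simp at this; linarith
    linarith [h1.1]
  have hgd : DifferentiableOn ℂ g (Icc a b ×ℂ Icc (-δ) δ) := by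
    intro s hs
    refine DifferentiableAt.differentiableWithinAt ?_
    exact (analyticAt_logDeriv_riemannZeta₁ (hZ s hs)).differentiableAt.mul
      (((differentiable_cpow_add_one hx) s).div (differentiableAt_id.add_const 1) (hne1 s hs))
  -- boundary points are `≠ 0`
  have hb_h : ∀ (y : ℝ), (y = -δ ∨ y = δ) → ∀ t ∈ Icc a b, ((t : ℂ) + y * I) ≠ 0 := by
    intro y hy t _ h
    have hy0 : y ≠ 0 := by rcases hy with rfl | rfl <;> simp [hδ.ne']
    exact hy0 (by simpa using congrArg Complex.im h)
  have hb_v : ∀ (t : ℝ), (t = a ∨ t = b) → ∀ y ∈ Icc (-δ) δ, ((t : ℂ) + y * I) ≠ 0 := by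
    intro t ht y _ h
    have ht0 : t ≠ 0 := by
      rcases ht with rfl | rfl
      · exact ha0.ne
      · exact hb.ne'
    exact ht0 (by simpa using congrArg Complex.re h)
  rw [Literature.Analysis.Complex.rectBoundaryIntegral_congr (G := fun s ↦ 1 * (g s / (s - 0))) hab hδδ
      (fun t ht ↦ hsplit _ (hb_h _ (Or.inl rfl) t ht)) (fun t ht ↦ hsplit _ (hb_h _ (Or.inr rfl) t ht))
      (fun y hy ↦ hsplit _ (hb_v _ (Or.inl rfl) y hy)) (fun y hy ↦ hsplit _ (hb_v _ (Or.inr rfl) y hy)),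
    Literature.Analysis.Complex.rectBoundaryIntegral_const_mul_div_sub 1 0 (by simp [ha0]) (by simp [hb])
      (by simp [hδ]) (by simp [hδ]) hgd]
  simp [hg]
  ring

/-- **An outer strip** for `ζ₁'/ζ₁ · k_x`: on a closed rectangle not meeting the real axis, with `ζ₁`
non-zero on its four edges, `∮ (ζ₁'/ζ₁) k_x = 2πi ∑_{ζ₁(ρ)=0 inside} m(ρ) k_x(ρ)` (weighted argument
principle; `k_x` is analytic off the real axis). [folklore] -/
theorem rectBoundaryIntegral_outer_zeta₁ {x a b c d : ℝ} (hx : 0 < x) (hab : a < b) (hcd : c < d)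
    (h0 : 0 < c ∨ d < 0)
    (h_bot : ∀ t ∈ Icc a b, riemannZeta₁ (t + c * I) ≠ 0)
    (h_top : ∀ t ∈ Icc a b, riemannZeta₁ (t + d * I) ≠ 0)
    (h_left : ∀ y ∈ Icc c d, riemannZeta₁ (a + y * I) ≠ 0)
    (h_right : ∀ y ∈ Icc c d, riemannZeta₁ (b + y * I) ≠ 0) :
    Literature.Analysis.Complex.rectBoundaryIntegral (fun s ↦ logDeriv riemannZeta₁ s * kernel x s) a b c d =
      2 * π * I * ∑ᶠ ρ ∈ {ρ : ℂ | riemannZeta₁ ρ = 0 ∧ ρ ∈ Ioo a b ×ℂ Ioo c d},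
        ((meromorphicOrderAt riemannZeta₁ ρ).untop₀ : ℂ) * kernel x ρ := by
  have him : ∀ z ∈ Icc a b ×ℂ Icc c d, z.im ≠ 0 := by
    intro z hz h
    have h1 : z.im ∈ Icc c d := hz.2
    rw [h] at h1
    rcases h0 with h0 | h0
    · linarith [h1.1]
    · linarith [h1.2]
  have key := Literature.Analysis.Complex.integral_boundary_rect_logDeriv_mul (f := riemannZeta₁) (g := kernel x)
    hab hcd (fun z _ ↦ differentiable_riemannZeta₁.analyticAt z)
    (fun z hz ↦ analyticAt_kernel_of_im_ne_zero hx (him z hz)) h_bot h_top h_left h_right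
  simp only [← logDeriv_apply] at key
  rw [← key, Literature.Analysis.Complex.rectBoundaryIntegral]

/-- **The rational piece** `k_x(s)/(s−1) = x^{s+1}(½/(s−1) − 1/s + ½/(s+1))` over the boundary of
`[a,b] × [−T,T]` with `−1 < a < 0`, `1 < b`: `2πi (x²/2 − x)` (Cauchy's formula at `1` and `0`;
the pole `−1` is outside). [folklore] -/
theorem rectBoundaryIntegral_kernel_div {x a b T : ℝ} (hx : 0 < x) (ha : -1 < a) (ha0 : a < 0)
    (hb : 1 < b) (hT : 0 < T) :
    Literature.Analysis.Complex.rectBoundaryIntegral (fun s ↦ kernel x s / (s - 1)) a b (-T) T =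
      2 * π * I * ((x : ℂ) ^ 2 / 2 - x) := by
  have hab : a ≤ b := by linarith
  have hTT : -T ≤ T := by linarith
  set e : ℂ → ℂ := fun s ↦ (x : ℂ) ^ (s + 1) with he
  have hed : Differentiable ℂ e := differentiable_cpow_add_one hx
  set G₁ : ℂ → ℂ := fun s ↦ (1 / 2) * (e s / (s - 1)) with hG₁
  set G₀ : ℂ → ℂ := fun s ↦ (-1) * (e s / (s - 0)) with hG₀
  set Gm : ℂ → ℂ := fun s ↦ (1 / 2) * (e s / (s + 1)) with hGm
  have hsplit : ∀ s : ℂ, s ≠ 0 → s ≠ 1 → s ≠ -1 →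
      kernel x s / (s - 1) = (G₁ s + G₀ s) + Gm s := by
    intro s h0 h1 hm1
    have h1' : s - 1 ≠ 0 := sub_ne_zero.2 h1
    have hm1' : s + 1 ≠ 0 := fun h ↦ hm1 (by linear_combination h)
    simp only [kernel, hG₁, hG₀, hGm, he, sub_zero]
    field_simp
    ring
  -- boundary points avoid `0, 1, -1`
  have hbdry_h : ∀ (y : ℝ), (y = -T ∨ y = T) → ∀ t ∈ Icc a b,
      ((t : ℂ) + y * I) ≠ 0 ∧ ((t : ℂ) + y * I) ≠ 1 ∧ ((t : ℂ) + y * I) ≠ -1 := by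
    intro y hy t _
    have hy0 : y ≠ 0 := by rcases hy with rfl | rfl <;> simp [hT.ne']
    exact ⟨fun h ↦ hy0 (by simpa using congrArg Complex.im h),
      fun h ↦ hy0 (by simpa using congrArg Complex.im h),
      fun h ↦ hy0 (by simpa using congrArg Complex.im h)⟩
  have hbdry_v : ∀ (t : ℝ), (t = a ∨ t = b) → ∀ y ∈ Icc (-T) T,
      ((t : ℂ) + y * I) ≠ 0 ∧ ((t : ℂ) + y * I) ≠ 1 ∧ ((t : ℂ) + y * I) ≠ -1 := by
    intro t ht y _
    have ht0 : t ≠ 0 := by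
      rcases ht with rfl | rfl
      · exact ha0.ne
      · exact (zero_lt_one.trans hb).ne'
    have ht1 : t ≠ 1 := by
      rcases ht with rfl | rfl
      · exact (ha0.trans zero_lt_one).ne
      · exact hb.ne'
    have htm : t ≠ -1 := by
      rcases ht with rfl | rfl
      · exact ha.ne'
      · intro h; linarith
    exact ⟨fun h ↦ ht0 (by simpa using congrArg Complex.re h),
      fun h ↦ ht1 (by simpa using congrArg Complex.re h),
      fun h ↦ htm (by simpa using congrArg Complex.re h)⟩
  -- continuity of the pieces at points `≠ 0, 1, -1`
  have hcont : ∀ (m ρ : ℂ) (z : ℂ), z - ρ ≠ 0 → ContinuousAt (fun s ↦ m * (e s / (s - ρ))) z := by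
    intro m ρ z hz
    exact continuousAt_const.mul (((hed z).continuousAt).div (continuousAt_id.sub continuousAt_const) hz)
  have hc1 : ∀ z : ℂ, z ≠ 1 → ContinuousAt G₁ z := fun z hz ↦ hcont _ _ _ (sub_ne_zero.2 hz)
  have hc0 : ∀ z : ℂ, z ≠ 0 → ContinuousAt G₀ z := fun z hz ↦ hcont _ _ _ (by simpa using hz)
  have hcm : ∀ z : ℂ, z ≠ -1 → ContinuousAt Gm z := by
    intro z hz
    have : z + 1 ≠ 0 := fun h ↦ hz (by linear_combination h)
    exact continuousAt_const.mul (((hed z).continuousAt).div (continuousAt_id.add continuousAt_const) this)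
  have hc10 : ∀ z : ℂ, z ≠ 0 → z ≠ 1 → ContinuousAt (fun s ↦ G₁ s + G₀ s) z :=
    fun z h0 h1 ↦ (hc1 z h1).add (hc0 z h0)
  rw [Literature.Analysis.Complex.rectBoundaryIntegral_congr (G := fun s ↦ (G₁ s + G₀ s) + Gm s) hab hTT
      (fun t ht ↦ hsplit _ (hbdry_h _ (Or.inl rfl) t ht).1 (hbdry_h _ (Or.inl rfl) t ht).2.1
        (hbdry_h _ (Or.inl rfl) t ht).2.2)
      (fun t ht ↦ hsplit _ (hbdry_h _ (Or.inr rfl) t ht).1 (hbdry_h _ (Or.inr rfl) t ht).2.1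
        (hbdry_h _ (Or.inr rfl) t ht).2.2)
      (fun y hy ↦ hsplit _ (hbdry_v _ (Or.inl rfl) y hy).1 (hbdry_v _ (Or.inl rfl) y hy).2.1
        (hbdry_v _ (Or.inl rfl) y hy).2.2)
      (fun y hy ↦ hsplit _ (hbdry_v _ (Or.inr rfl) y hy).1 (hbdry_v _ (Or.inr rfl) y hy).2.1
        (hbdry_v _ (Or.inr rfl) y hy).2.2)]
  rw [Literature.Analysis.Complex.rectBoundaryIntegral_add (F := fun s ↦ G₁ s + G₀ s) (G := Gm) hab hTT
      (fun t ht ↦ hc10 _ (hbdry_h _ (Or.inl rfl) t ht).1 (hbdry_h _ (Or.inl rfl) t ht).2.1)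
      (fun t ht ↦ hc10 _ (hbdry_h _ (Or.inr rfl) t ht).1 (hbdry_h _ (Or.inr rfl) t ht).2.1)
      (fun y hy ↦ hc10 _ (hbdry_v _ (Or.inl rfl) y hy).1 (hbdry_v _ (Or.inl rfl) y hy).2.1)
      (fun y hy ↦ hc10 _ (hbdry_v _ (Or.inr rfl) y hy).1 (hbdry_v _ (Or.inr rfl) y hy).2.1)
      (fun t ht ↦ hcm _ (hbdry_h _ (Or.inl rfl) t ht).2.2)
      (fun t ht ↦ hcm _ (hbdry_h _ (Or.inr rfl) t ht).2.2)
      (fun y hy ↦ hcm _ (hbdry_v _ (Or.inl rfl) y hy).2.2)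
      (fun y hy ↦ hcm _ (hbdry_v _ (Or.inr rfl) y hy).2.2),
    Literature.Analysis.Complex.rectBoundaryIntegral_add (F := G₁) (G := G₀) hab hTT
      (fun t ht ↦ hc1 _ (hbdry_h _ (Or.inl rfl) t ht).2.1)
      (fun t ht ↦ hc1 _ (hbdry_h _ (Or.inr rfl) t ht).2.1)
      (fun y hy ↦ hc1 _ (hbdry_v _ (Or.inl rfl) y hy).2.1)
      (fun y hy ↦ hc1 _ (hbdry_v _ (Or.inr rfl) y hy).2.1)
      (fun t ht ↦ hc0 _ (hbdry_h _ (Or.inl rfl) t ht).1)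
      (fun t ht ↦ hc0 _ (hbdry_h _ (Or.inr rfl) t ht).1)
      (fun y hy ↦ hc0 _ (hbdry_v _ (Or.inl rfl) y hy).1)
      (fun y hy ↦ hc0 _ (hbdry_v _ (Or.inr rfl) y hy).1)]
  -- the three evaluations
  have hedOn : DifferentiableOn ℂ e (Icc a b ×ℂ Icc (-T) T) := hed.differentiableOn
  rw [Literature.Analysis.Complex.rectBoundaryIntegral_const_mul_div_sub (1 / 2) 1 (by simp; linarith)
      (by simp; linarith) (by simp [hT]) (by simp [hT]) hedOn,
    Literature.Analysis.Complex.rectBoundaryIntegral_const_mul_div_sub (-1) 0 (by simp [ha0]) (by simp; linarith)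
      (by simp [hT]) (by simp [hT]) hedOn]
  have hGm0 : Literature.Analysis.Complex.rectBoundaryIntegral Gm a b (-T) T = 0 := by
    refine Literature.Analysis.Complex.rectBoundaryIntegral_eq_zero_of_differentiableOn hab hTT fun s hs ↦ ?_
    have h1 : s.re ∈ Icc a b := hs.1
    have hs1 : s + 1 ≠ 0 := by
      intro h
      have : s.re = -1 := by have := congrArg Complex.re h; simp at this; linarith
      linarith [h1.1]
    exact ((differentiableAt_const _).mul ((hed s).div (differentiableAt_id.add_const 1)
      hs1)).differentiableWithinAt
  rw [hGm0]
  simp only [he]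
  rw [show ((1 : ℂ) + 1) = 2 by norm_num, show ((0 : ℂ) + 1) = 1 by norm_num, cpow_two, cpow_one]
  ring

/-- `ζ₁'/ζ₁(0) = log 2π − 1` (`ζ(0) = −1/2`, `ζ'(0) = −½ log 2π`, `ζ₁ = (s−1)ζ`). [folklore] -/
theorem logDeriv_riemannZeta₁_zero : logDeriv riemannZeta₁ 0 = Complex.log (2 * π) - 1 := by
  have hζ : riemannZeta 0 ≠ 0 := by rw [riemannZeta_zero]; norm_num
  have h := logDeriv_riemannZeta_eq (s := 0) zero_ne_one hζ
  rw [logDeriv_apply, deriv_riemannZeta_zero, riemannZeta_zero] at h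
  have : logDeriv riemannZeta₁ 0 = -Complex.log (2 * π) / 2 / (-1 / 2) + (0 - 1)⁻¹ := by
    rw [h]; ring
  rw [this]
  ring

/-! ### Non-vanishing near the real axis and on the contour -/

/-- With a gap `2δ ≤ |Im ρ|` for the non-trivial zeros: `ζ(z) ≠ 0` whenever `|Im z| < 2δ` and
`Re z > −2` (a zero off the axis would be non-trivial; a real zero with `Re > −2` does not exist:
`ζ ≠ 0` on `Re ≥ 1`, non-trivial zeros are off the axis, and the zeros with `Re ≤ 0` are
`−2, −4, …`). [folklore] -/
theorem riemannZeta_ne_zero_of_abs_im_lt {δ : ℝ}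
    (hgap : ∀ ρ ∈ RHWave0.riemannZetaNontrivialZeros, 2 * δ ≤ |ρ.im|) {z : ℂ} (hz : |z.im| < 2 * δ)
    (hre : -2 < z.re) : riemannZeta z ≠ 0 := by
  intro h0
  by_cases him : z.im = 0
  · rcases le_or_gt z.re 0 with h | h
    · obtain ⟨n, hn⟩ := (riemannZeta_eq_zero_iff_of_re_nonpos h).1 h0
      have := congrArg Complex.re hn
      simp at this
      linarith [(n.cast_nonneg : (0 : ℝ) ≤ n)]
    rcases lt_or_ge z.re 1 with h1 | h1
    · exact ZetaZeros.riemannZetaNontrivialZeros.im_ne_zero (ZetaZeros.riemannZetaNontrivialZeros.mem_iff'.2 ⟨h0, h, h1⟩) him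
    · exact riemannZeta_ne_zero_of_one_le_re h1 h0
  · have := hgap z (ZetaZeros.riemannZetaNontrivialZeros.mem_of_im_ne_zero h0 him)
    linarith

/-- Same for `ζ₁ = (s−1)ζ` (and `ζ₁(1) = 1`). [folklore] -/
theorem riemannZeta₁_ne_zero_of_abs_im_lt {δ : ℝ}
    (hgap : ∀ ρ ∈ RHWave0.riemannZetaNontrivialZeros, 2 * δ ≤ |ρ.im|) {z : ℂ} (hz : |z.im| < 2 * δ)
    (hre : -2 < z.re) : riemannZeta₁ z ≠ 0 := by
  by_cases h1 : z = 1
  · rw [h1, riemannZeta₁_one]; exact one_ne_zero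
  · exact fun h ↦ riemannZeta_ne_zero_of_abs_im_lt hgap hz hre (riemannZeta_eq_zero_of_riemannZeta₁ h)

/-- `ζ₁ ≠ 0` on the lines `Re s = 3/2` and `Re s = −1/2`. [folklore] -/
theorem riemannZeta₁_ne_zero_vertical {t : ℝ} (ht : t = 3 / 2 ∨ t = -(1 / 2)) (y : ℝ) :
    riemannZeta₁ ((t : ℂ) + y * I) ≠ 0 := by
  have h1 : ((t : ℂ) + y * I) ≠ 1 := by
    intro h; have := congrArg Complex.re h; simp at this; rcases ht with rfl | rfl <;> norm_num at this
  rw [Ne, riemannZeta₁_eq_zero_iff h1]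
  rcases ht with rfl | rfl
  · exact riemannZeta_ne_zero_of_one_le_re (by simp; norm_num)
  · exact riemannZeta_left_ne_zero y

/-! ### The contour identity for `ψ₁` -/

/-- The integrand off the zeros: `G_x = −(ζ₁'/ζ₁) k_x + k_x/(s−1)`. [folklore] -/
theorem integrand_eq_split {x : ℝ} {s : ℂ} (hs1 : s ≠ 1) (hζ : riemannZeta s ≠ 0) :
    integrand x s = (-1) * (logDeriv riemannZeta₁ s * kernel x s) + kernel x s / (s - 1) := by
  rw [integrand_eq, neg_div, ← logDeriv_apply, logDeriv_riemannZeta_eq hs1 hζ]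
  ring

/-- **The contour identity for `ψ₁`.** Let `0 < δ ≤ 1/2` be a gap for the ordinates, `x > 0`, and
let `T ≥ 2` be `±` no ordinate of a zero. Then
`∮_{∂([−1/2, 3/2] × [−T, T])} (−ζ'/ζ) k_x = 2πi (x²/2 − ∑_{|Im ρ| ≤ T} m(ρ) k_x(ρ) − x log 2π)`.
[cite: MontgomeryVaughan2007, §12.1 (proof of Thm. 12.5, with the kernel of (5.19))] -/
theorem contour_identity_psiOne {x δ T : ℝ} (hx : 0 < x) (hδ : 0 < δ) (hδ2 : δ ≤ 1 / 2)
    (hgap : ∀ ρ ∈ RHWave0.riemannZetaNontrivialZeros, 2 * δ ≤ |ρ.im|)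
    (hT : 2 ≤ T) (hgood : ∀ ρ ∈ RHWave0.riemannZetaNontrivialZeros, ρ.im ≠ T ∧ ρ.im ≠ -T) :
    Literature.Analysis.Complex.rectBoundaryIntegral (integrand x) (-(1 / 2)) (3 / 2) (-T) T =
      2 * π * I * ((x : ℂ) ^ 2 / 2 -
        ∑ ρ ∈ weilZeroFinset T, (riemannZetaZeroOrder (ρ : ℂ) : ℂ) * kernel x ρ -
          x * Complex.log (2 * π)) := by
  have hδT : δ < T := by linarith
  have hT0 : (0 : ℝ) < T := by linarith
  have hab : (-(1 / 2) : ℝ) ≤ 3 / 2 := by norm_num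
  -- non-vanishing
  have hζ_T : ∀ s : ℂ, |s.im| = T → riemannZeta s ≠ 0 := by
    intro s hs h0
    have him : s.im ≠ 0 := fun h ↦ by rw [h, abs_zero] at hs; linarith
    obtain ⟨h1, h2⟩ := hgood s (ZetaZeros.riemannZetaNontrivialZeros.mem_of_im_ne_zero h0 him)
    rcases (abs_eq hT0.le).1 hs with h | h
    · exact h1 h
    · exact h2 h
  have hζ₁_T : ∀ s : ℂ, |s.im| = T → riemannZeta₁ s ≠ 0 := by
    intro s hs h
    have h1 : s ≠ 1 := fun h1 ↦ by rw [h1] at hs; simp at hs; linarith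
    exact hζ_T s hs (riemannZeta_eq_zero_of_riemannZeta₁ h)
  have him_T : ∀ (t : ℝ) (y : ℝ), (y = -T ∨ y = T) → |((t : ℂ) + y * I).im| = T := by
    intro t y hy; rcases hy with rfl | rfl <;> simp [abs_of_pos hT0]
  have him_δ : ∀ (t : ℝ) (y : ℝ), (y = -δ ∨ y = δ) → |((t : ℂ) + y * I).im| < 2 * δ := by
    intro t y hy; rcases hy with rfl | rfl <;> simp [abs_of_pos hδ] <;> linarith
  -- the integrand splits on the boundary (where `ζ ≠ 0`, `s ≠ 1`)
  have hbdry : ∀ z : ℂ, (|z.im| = T ∨ (z.re = 3 / 2 ∨ z.re = -(1 / 2))) →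
      riemannZeta z ≠ 0 ∧ z ≠ 1 ∧ z ≠ 0 ∧ z ≠ -1 ∧ riemannZeta₁ z ≠ 0 := by
    intro z hz
    rcases hz with hz | hz
    · have him : z.im ≠ 0 := fun h ↦ by rw [h, abs_zero] at hz; linarith
      exact ⟨hζ_T z hz, fun h ↦ him (by simp [h]), fun h ↦ him (by simp [h]),
        fun h ↦ him (by simp [h]), hζ₁_T z hz⟩
    · have hz' : z = ((z.re : ℝ) : ℂ) + (z.im : ℝ) * I := (Complex.re_add_im z).symm
      have hne : z ≠ 1 ∧ z ≠ 0 ∧ z ≠ -1 := by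
        refine ⟨fun h ↦ ?_, fun h ↦ ?_, fun h ↦ ?_⟩ <;> rw [h] at hz <;> simp at hz <;> norm_num at hz
      have hζ₁ : riemannZeta₁ z ≠ 0 := by
        rw [hz']
        exact riemannZeta₁_ne_zero_vertical (by rcases hz with h | h <;> simp [h]) z.im
      exact ⟨fun h ↦ hζ₁ (by rw [riemannZeta₁_eq_mul hne.1, h, mul_zero]), hne.1, hne.2.1,
        hne.2.2, hζ₁⟩
  set F₁ : ℂ → ℂ := fun s ↦ (-1) * (logDeriv riemannZeta₁ s * kernel x s) with hF₁
  set F₂ : ℂ → ℂ := fun s ↦ kernel x s / (s - 1) with hF₂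
  have hcF₁ : ∀ z : ℂ, riemannZeta₁ z ≠ 0 → z ≠ 0 → z ≠ -1 → ContinuousAt F₁ z := by
    intro z hζ h0 h1
    exact continuousAt_const.mul (((analyticAt_logDeriv_riemannZeta₁ hζ).continuousAt).mul
      (analyticAt_kernel hx h0 h1).continuousAt)
  have hcF₂ : ∀ z : ℂ, z ≠ 0 → z ≠ 1 → z ≠ -1 → ContinuousAt F₂ z := by
    intro z h0 h1 hm1
    exact ((analyticAt_kernel hx h0 hm1).continuousAt).div (continuousAt_id.sub continuousAt_const)
      (sub_ne_zero.2 h1)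
  have hbot : ∀ t ∈ Icc (-(1 / 2) : ℝ) (3 / 2), |((t : ℂ) + ((-T : ℝ) : ℂ) * I).im| = T :=
    fun t _ ↦ him_T t _ (Or.inl rfl)
  have htop : ∀ t ∈ Icc (-(1 / 2) : ℝ) (3 / 2), |((t : ℂ) + (T : ℂ) * I).im| = T :=
    fun t _ ↦ him_T t _ (Or.inr rfl)
  have hleft : ∀ y : ℝ, ((((-(1 / 2) : ℝ)) : ℂ) + y * I).re = 3 / 2 ∨
      ((((-(1 / 2) : ℝ)) : ℂ) + y * I).re = -(1 / 2) := fun y ↦ Or.inr (by simp)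
  have hright : ∀ y : ℝ, (((3 / 2 : ℝ) : ℂ) + y * I).re = 3 / 2 ∨
      (((3 / 2 : ℝ) : ℂ) + y * I).re = -(1 / 2) := fun y ↦ Or.inl (by simp)
  rw [Literature.Analysis.Complex.rectBoundaryIntegral_congr (G := fun s ↦ F₁ s + F₂ s) hab (by linarith)
      (fun t ht ↦ integrand_eq_split (hbdry _ (Or.inl (hbot t ht))).2.1 (hbdry _ (Or.inl (hbot t ht))).1)
      (fun t ht ↦ integrand_eq_split (hbdry _ (Or.inl (htop t ht))).2.1 (hbdry _ (Or.inl (htop t ht))).1)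
      (fun y _ ↦ integrand_eq_split (hbdry _ (Or.inr (hleft y))).2.1 (hbdry _ (Or.inr (hleft y))).1)
      (fun y _ ↦ integrand_eq_split (hbdry _ (Or.inr (hright y))).2.1 (hbdry _ (Or.inr (hright y))).1),
    Literature.Analysis.Complex.rectBoundaryIntegral_add (F := F₁) (G := F₂) hab (by linarith)
      (fun t ht ↦ hcF₁ _ (hbdry _ (Or.inl (hbot t ht))).2.2.2.2 (hbdry _ (Or.inl (hbot t ht))).2.2.1
        (hbdry _ (Or.inl (hbot t ht))).2.2.2.1)
      (fun t ht ↦ hcF₁ _ (hbdry _ (Or.inl (htop t ht))).2.2.2.2 (hbdry _ (Or.inl (htop t ht))).2.2.1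
        (hbdry _ (Or.inl (htop t ht))).2.2.2.1)
      (fun y _ ↦ hcF₁ _ (hbdry _ (Or.inr (hleft y))).2.2.2.2 (hbdry _ (Or.inr (hleft y))).2.2.1
        (hbdry _ (Or.inr (hleft y))).2.2.2.1)
      (fun y _ ↦ hcF₁ _ (hbdry _ (Or.inr (hright y))).2.2.2.2 (hbdry _ (Or.inr (hright y))).2.2.1
        (hbdry _ (Or.inr (hright y))).2.2.2.1)
      (fun t ht ↦ hcF₂ _ (hbdry _ (Or.inl (hbot t ht))).2.2.1 (hbdry _ (Or.inl (hbot t ht))).2.1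
        (hbdry _ (Or.inl (hbot t ht))).2.2.2.1)
      (fun t ht ↦ hcF₂ _ (hbdry _ (Or.inl (htop t ht))).2.2.1 (hbdry _ (Or.inl (htop t ht))).2.1
        (hbdry _ (Or.inl (htop t ht))).2.2.2.1)
      (fun y _ ↦ hcF₂ _ (hbdry _ (Or.inr (hleft y))).2.2.1 (hbdry _ (Or.inr (hleft y))).2.1
        (hbdry _ (Or.inr (hleft y))).2.2.2.1)
      (fun y _ ↦ hcF₂ _ (hbdry _ (Or.inr (hright y))).2.2.1 (hbdry _ (Or.inr (hright y))).2.1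
        (hbdry _ (Or.inr (hright y))).2.2.2.1),
    hF₂, rectBoundaryIntegral_kernel_div hx (by norm_num) (by norm_num) (by norm_num) hT0,
    hF₁, Literature.Analysis.Complex.rectBoundaryIntegral_const_mul]
  -- the `ζ₁'/ζ₁ k` piece: cut along `Im s = ±δ`
  set P : ℂ → ℂ := fun s ↦ logDeriv riemannZeta₁ s * kernel x s with hP
  have hcP : ∀ (t : ℝ), (t = -(1 / 2) ∨ t = 3 / 2) → ∀ y : ℝ, ContinuousAt P ((t : ℂ) + y * I) := by
    intro t ht y
    have h := hbdry ((t : ℂ) + y * I) (Or.inr (by rcases ht with rfl | rfl <;> simp))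
    exact ((analyticAt_logDeriv_riemannZeta₁ h.2.2.2.2).continuousAt).mul
      (analyticAt_kernel hx h.2.2.1 h.2.2.2.1).continuousAt
  have hii : ∀ (t : ℝ), (t = -(1 / 2) ∨ t = 3 / 2) → ∀ c d : ℝ, c ≤ d →
      IntervalIntegrable (fun y : ℝ ↦ P ((t : ℂ) + y * I)) volume c d := fun t ht c d hcd ↦
    Literature.Analysis.Complex.intervalIntegrable_of_continuousAt_vertical t hcd fun y _ ↦ hcP t ht y
  rw [ZetaZeroSum.rectBoundaryIntegral_split (e := -δ) (hii _ (Or.inl rfl) _ _ (by linarith))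
      (hii _ (Or.inl rfl) _ _ (by linarith)) (hii _ (Or.inr rfl) _ _ (by linarith))
      (hii _ (Or.inr rfl) _ _ (by linarith)),
    ZetaZeroSum.rectBoundaryIntegral_split (c := -δ) (e := δ) (d := T)
      (hii _ (Or.inl rfl) _ _ (by linarith)) (hii _ (Or.inl rfl) _ _ (by linarith))
      (hii _ (Or.inr rfl) _ _ (by linarith)) (hii _ (Or.inr rfl) _ _ (by linarith))]
  have hvert : ∀ (t : ℝ), (t = -(1 / 2) ∨ t = 3 / 2) → ∀ y : ℝ, riemannZeta₁ ((t : ℂ) + y * I) ≠ 0 :=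
    fun t ht y ↦ (hbdry _ (Or.inr (by rcases ht with rfl | rfl <;> simp))).2.2.2.2
  rw [rectBoundaryIntegral_outer_zeta₁ hx (by norm_num) (by linarith : -T < -δ) (Or.inr (by linarith))
      (fun t _ ↦ hζ₁_T _ (him_T t _ (Or.inl rfl)))
      (fun t ht ↦ riemannZeta₁_ne_zero_of_abs_im_lt hgap (him_δ t _ (Or.inl rfl))
        (by simp; linarith [ht.1]))
      (fun y _ ↦ hvert _ (Or.inl rfl) y) (fun y _ ↦ hvert _ (Or.inr rfl) y),
    rectBoundaryIntegral_middle_zeta₁ hx (by norm_num) (by norm_num) (by norm_num) hδ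
      (fun s hs ↦ riemannZeta₁_ne_zero_of_abs_im_lt hgap (by
        have h := (Complex.mem_reProdIm.1 hs).2
        rw [abs_lt]; constructor <;> linarith [h.1, h.2]) (by
        have h := (Complex.mem_reProdIm.1 hs).1; linarith [h.1])),
    rectBoundaryIntegral_outer_zeta₁ hx (by norm_num) hδT (Or.inl hδ)
      (fun t ht ↦ riemannZeta₁_ne_zero_of_abs_im_lt hgap (him_δ t _ (Or.inr rfl))
        (by simp; linarith [ht.1]))
      (fun t _ ↦ hζ₁_T _ (him_T t _ (Or.inr rfl)))
      (fun y _ ↦ hvert _ (Or.inl rfl) y) (fun y _ ↦ hvert _ (Or.inr rfl) y),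
    logDeriv_riemannZeta₁_zero]
  -- the zero sets
  set f : ℂ → ℂ := fun ρ ↦ ((meromorphicOrderAt riemannZeta₁ ρ).untop₀ : ℂ) * kernel x ρ with hf
  set Zp : Set ℂ := {ρ : ℂ | riemannZeta₁ ρ = 0 ∧ ρ ∈ Ioo (-(1 / 2) : ℝ) (3 / 2) ×ℂ Ioo δ T} with hZp
  set Zm : Set ℂ := {ρ : ℂ | riemannZeta₁ ρ = 0 ∧ ρ ∈ Ioo (-(1 / 2) : ℝ) (3 / 2) ×ℂ Ioo (-T) (-δ)}
    with hZm
  have hunion : Zp ∪ Zm = weilZeroIndex T := by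
    ext ρ
    simp only [hZp, hZm, mem_union, mem_setOf_eq, Complex.mem_reProdIm, mem_Ioo, weilZeroIndex]
    constructor
    · rintro (⟨h0, -, hi1, hi2⟩ | ⟨h0, -, hi1, hi2⟩)
      · have him : ρ.im ≠ 0 := by intro h; rw [h] at hi1; linarith
        have hζ := riemannZeta_eq_zero_of_riemannZeta₁ h0
        have hmem := ZetaZeros.riemannZetaNontrivialZeros.mem_of_im_ne_zero hζ him
        exact ⟨hζ, (ZetaZeros.riemannZetaNontrivialZeros.re_pos hmem).le,
          (ZetaZeros.riemannZetaNontrivialZeros.re_lt_one hmem).le, him, abs_le.2 ⟨by linarith, hi2.le⟩⟩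
      · have him : ρ.im ≠ 0 := by intro h; rw [h] at hi2; linarith
        have hζ := riemannZeta_eq_zero_of_riemannZeta₁ h0
        have hmem := ZetaZeros.riemannZetaNontrivialZeros.mem_of_im_ne_zero hζ him
        exact ⟨hζ, (ZetaZeros.riemannZetaNontrivialZeros.re_pos hmem).le,
          (ZetaZeros.riemannZetaNontrivialZeros.re_lt_one hmem).le, him, abs_le.2 ⟨hi1.le, by linarith⟩⟩
    · intro h
      have hmem : ρ ∈ RHWave0.riemannZetaNontrivialZeros :=
        ZetaZeros.riemannZetaNontrivialZeros.mem_of_im_ne_zero h.1 h.2.2.2.1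
      have hρ1 : ρ ≠ 1 := ZetaZeros.riemannZetaNontrivialZeros.ne_one hmem
      have hξ0 : riemannZeta₁ ρ = 0 := (riemannZeta₁_eq_zero_iff hρ1).2 h.1
      have hre0 := ZetaZeros.riemannZetaNontrivialZeros.re_pos hmem
      have hre1 := ZetaZeros.riemannZetaNontrivialZeros.re_lt_one hmem
      have habs : |ρ.im| ≤ T := h.2.2.2.2
      obtain ⟨hne1, hne2⟩ := hgood ρ hmem
      have hlt1 : ρ.im < T := lt_of_le_of_ne (abs_le.1 habs).2 hne1
      have hlt2 : -T < ρ.im := lt_of_le_of_ne (abs_le.1 habs).1 (Ne.symm hne2)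
      have hg := hgap ρ hmem
      have hre : -(1 / 2) < ρ.re ∧ ρ.re < 3 / 2 := ⟨by linarith, by linarith⟩
      rcases le_or_gt 0 ρ.im with hi | hi
      · rw [abs_of_nonneg hi] at hg
        exact Or.inl ⟨hξ0, hre, by linarith, hlt1⟩
      · rw [abs_of_neg hi] at hg
        exact Or.inr ⟨hξ0, hre, hlt2, by linarith⟩
  have hdisj : Disjoint Zp Zm := by
    rw [Set.disjoint_left]
    rintro ρ ⟨-, -, h1, -⟩ ⟨-, -, -, h2⟩
    linarith
  have hfin : (weilZeroIndex T).Finite := weilZeroIndex_finite T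
  have hZpf : Zp.Finite := hfin.subset (hunion ▸ subset_union_left)
  have hZmf : Zm.Finite := hfin.subset (hunion ▸ subset_union_right)
  have hsum : ∑ᶠ ρ ∈ Zm, f ρ + ∑ᶠ ρ ∈ Zp, f ρ =
      ∑ ρ ∈ weilZeroFinset T, (riemannZetaZeroOrder (ρ : ℂ) : ℂ) * kernel x ρ := by
    rw [add_comm, ← finsum_mem_union hdisj hZpf hZmf, hunion,
      ← ZetaZeroSum.finsum_mem_weilZeroIndex_eq_sum (fun ρ ↦ (riemannZetaZeroOrder ρ : ℂ) * kernel x ρ) T]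
    refine finsum_mem_congr rfl fun ρ hρ ↦ ?_
    have hmem : ρ ∈ RHWave0.riemannZetaNontrivialZeros := by
      rw [weilZeroIndex_eq_inter] at hρ; exact hρ.1
    simp only [hf, riemannZetaZeroOrder]
    rw [meromorphicOrderAt_riemannZeta₁_eq (ZetaZeros.riemannZetaNontrivialZeros.ne_one hmem)]
  change -1 * (2 * π * I * ∑ᶠ ρ ∈ Zm, f ρ +
      (2 * π * I * ((x : ℂ) * (Complex.log (2 * π) - 1)) + 2 * π * I * ∑ᶠ ρ ∈ Zp, f ρ)) +
    2 * π * I * ((x : ℂ) ^ 2 / 2 - x) = _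
  rw [← hsum]
  ring

/-! ### The integrand on the contour: continuity, bounds, integrability -/

/-- The integrand is continuous at every `z ∉ {0, ±1}` with `ζ(z) ≠ 0`. [folklore] -/
theorem continuousAt_integrand {x : ℝ} (hx : 0 < x) {z : ℂ} (hζ : riemannZeta z ≠ 0) (h0 : z ≠ 0)
    (h1 : z ≠ 1) (hm1 : z ≠ -1) : ContinuousAt (integrand x) z := by
  have hopen : IsOpen {w : ℂ | riemannZeta w ≠ 0 ∧ w ≠ 1} := by
    have h1 : IsOpen ({1}ᶜ : Set ℂ) := isOpen_compl_singleton
    have hc : ContinuousOn riemannZeta ({1}ᶜ : Set ℂ) := fun w hw ↦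
      (differentiableAt_riemannZeta hw).continuousAt.continuousWithinAt
    have := hc.isOpen_inter_preimage h1 isOpen_ne (t := {(0 : ℂ)}ᶜ)
    convert this using 1
    ext w; simp [and_comm]
  have hev : integrand x =ᶠ[𝓝 z] fun s ↦
      (-1) * (logDeriv riemannZeta₁ s * kernel x s) + kernel x s / (s - 1) := by
    filter_upwards [hopen.mem_nhds ⟨hζ, h1⟩] with w hw
    exact integrand_eq_split hw.2 hw.1
  refine ContinuousAt.congr ?_ hev.symm
  have hζ₁ : riemannZeta₁ z ≠ 0 := by
    rw [riemannZeta₁_eq_mul h1]; exact mul_ne_zero (sub_ne_zero.2 h1) hζ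
  exact (continuousAt_const.mul (((analyticAt_logDeriv_riemannZeta₁ hζ₁).continuousAt).mul
    (analyticAt_kernel hx h0 hm1).continuousAt)).add
    (((analyticAt_kernel hx h0 hm1).continuousAt).div (continuousAt_id.sub continuousAt_const)
      (sub_ne_zero.2 h1))

/-- `x^{σ+1} ≤ x^{5/2}` for `x ≥ 1`, `σ ≤ 3/2`. [folklore] -/
theorem rpow_re_add_one_le {x : ℝ} (hx : 1 ≤ x) {σ : ℝ} (hσ : σ ≤ 3 / 2) :
    x ^ (σ + 1) ≤ x ^ (5 / 2 : ℝ) :=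
  Real.rpow_le_rpow_of_exponent_le hx (by linarith)

/-- **The horizontal sides**, pointwise: at a good height (`|t| ≥ 2`, all non-trivial zeros
`η`-away from the ordinate `t`), for `σ ∈ [−1/2, 3/2]` and `x ≥ 1`,
`‖G_x(σ + it)‖ ≤ (C log(|t|+4)/η) · x^{5/2}/t²`. [cite: MontgomeryVaughan2007, §12.1 (proof of Thm. 12.5)] -/
theorem norm_integrand_horizontal_le {C : ℝ}
    (hC : ∀ (t η : ℝ), 2 ≤ |t| → 0 < η → η ≤ 1 →
      (∀ ρ ∈ RHWave0.riemannZetaNontrivialZeros, η ≤ |ρ.im - t|) →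
      ∀ σ : ℝ, σ ∈ Icc (-(1 / 2) : ℝ) (3 / 2) →
        ‖deriv riemannZeta (σ + t * I) / riemannZeta (σ + t * I)‖ ≤ C * Real.log (|t| + 4) / η)
    {x t η : ℝ} (hx : 1 ≤ x) (ht : 2 ≤ |t|) (hη : 0 < η) (hη1 : η ≤ 1)
    (hsep : ∀ ρ ∈ RHWave0.riemannZetaNontrivialZeros, η ≤ |ρ.im - t|) {σ : ℝ}
    (hσ : σ ∈ Icc (-(1 / 2) : ℝ) (3 / 2)) :
    ‖integrand x (σ + t * I)‖ ≤ C * Real.log (|t| + 4) / η * (x ^ (5 / 2 : ℝ) / t ^ 2) := by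
  have hx0 : 0 < x := by linarith
  have h1 := hC t η ht hη hη1 hsep σ hσ
  have hC0 : 0 ≤ C * Real.log (|t| + 4) / η := (norm_nonneg _).trans h1
  rw [integrand_eq, norm_mul, neg_div, norm_neg, norm_kernel hx0]
  refine mul_le_mul h1 ?_ (by positivity) hC0
  have hsre : ((σ : ℂ) + t * I).re = σ := by simp
  rw [hsre]
  have hn1 : |t| ≤ ‖(σ : ℂ) + t * I‖ := by
    have := Complex.abs_im_le_norm ((σ : ℂ) + t * I); simpa using this
  have hn2 : |t| ≤ ‖(σ : ℂ) + t * I + 1‖ := by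
    have := Complex.abs_im_le_norm ((σ : ℂ) + t * I + 1); simpa using this
  have ht0 : 0 < |t| := by linarith
  calc x ^ (σ + 1) / (‖(σ : ℂ) + t * I‖ * ‖(σ : ℂ) + t * I + 1‖)
      ≤ x ^ (5 / 2 : ℝ) / (|t| * |t|) := by
        refine div_le_div₀ (by positivity) (rpow_re_add_one_le hx hσ.2) (by positivity) ?_
        exact mul_le_mul hn1 hn2 ht0.le (norm_nonneg _)
    _ = x ^ (5 / 2 : ℝ) / t ^ 2 := by rw [← sq, sq_abs]

/-- **The horizontal sides**: `‖∫_{−1/2}^{3/2} G_x(σ ± iT) dσ‖ ≤ 2 (C log(T+4)/η) x^{5/2}/T²`.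
[cite: MontgomeryVaughan2007, §12.1 (proof of Thm. 12.5)] -/
theorem norm_integral_horizontal_le {C : ℝ}
    (hC : ∀ (t η : ℝ), 2 ≤ |t| → 0 < η → η ≤ 1 →
      (∀ ρ ∈ RHWave0.riemannZetaNontrivialZeros, η ≤ |ρ.im - t|) →
      ∀ σ : ℝ, σ ∈ Icc (-(1 / 2) : ℝ) (3 / 2) →
        ‖deriv riemannZeta (σ + t * I) / riemannZeta (σ + t * I)‖ ≤ C * Real.log (|t| + 4) / η)
    {x T η t : ℝ} (hx : 1 ≤ x) (hT : 2 ≤ T) (ht : t = T ∨ t = -T) (hη : 0 < η) (hη1 : η ≤ 1)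
    (hsep : ∀ ρ ∈ RHWave0.riemannZetaNontrivialZeros, η ≤ |ρ.im - t|) :
    ‖∫ σ : ℝ in (-(1 / 2) : ℝ)..(3 / 2), integrand x (σ + t * I)‖ ≤
      C * Real.log (T + 4) / η * (x ^ (5 / 2 : ℝ) / T ^ 2) * 2 := by
  have htabs : |t| = T := by
    rcases ht with rfl | rfl
    · exact abs_of_pos (by linarith)
    · rw [abs_neg]; exact abs_of_pos (by linarith)
  have ht2 : t ^ 2 = T ^ 2 := by rw [← sq_abs, htabs]
  have h := intervalIntegral.norm_integral_le_of_norm_le_const (a := (-(1 / 2) : ℝ)) (b := 3 / 2)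
    (C := C * Real.log (T + 4) / η * (x ^ (5 / 2 : ℝ) / T ^ 2))
    (f := fun σ : ℝ ↦ integrand x (σ + t * I)) ?_
  · rwa [show |(3 / 2 : ℝ) - -(1 / 2)| = 2 by norm_num] at h
  intro σ hσ
  rw [uIoc_of_le (by norm_num)] at hσ
  have := norm_integrand_horizontal_le hC hx (by rw [htabs]; exact hT) hη hη1 hsep ⟨hσ.1.le, hσ.2⟩
  rwa [htabs, ht2] at this

/-- `‖(−1/2 + it)(1/2 + it)‖ = 1/4 + t²`. [folklore] -/
theorem norm_left_den (t : ℝ) :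
    ‖(((-(1 / 2) : ℝ) : ℂ) + t * I)‖ * ‖(((-(1 / 2) : ℝ) : ℂ) + t * I + 1)‖ = 1 / 4 + t ^ 2 := by
  have h1 : ‖(((-(1 / 2) : ℝ) : ℂ) + t * I)‖ = Real.sqrt (1 / 4 + t ^ 2) := by
    rw [Complex.norm_def, Complex.normSq_apply]; congr 1; simp; ring
  have h2 : ‖(((-(1 / 2) : ℝ) : ℂ) + t * I + 1)‖ = Real.sqrt (1 / 4 + t ^ 2) := by
    rw [Complex.norm_def, Complex.normSq_apply]; congr 1; simp; ring
  rw [h1, h2, Real.mul_self_sqrt (by positivity)]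

/-- **The left line, pointwise**: with `C` from `exists_norm_logDeriv_riemannZeta_left_le`,
`‖G_x(−1/2 + it)‖ ≤ √x (C + 2 log(1+|t|))/(1/4 + t²)` (`x > 0`). [folklore] -/
theorem norm_integrand_left_le {C : ℝ}
    (hC : ∀ t : ℝ, ‖deriv riemannZeta ((-(1 / 2) : ℝ) + t * I) /
      riemannZeta ((-(1 / 2) : ℝ) + t * I)‖ ≤ C + 2 * Real.log (1 + |t|))
    {x : ℝ} (hx : 0 < x) (t : ℝ) :
    ‖integrand x (((-(1 / 2) : ℝ) : ℂ) + t * I)‖ ≤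
      Real.sqrt x * ((C + 2 * Real.log (1 + |t|)) / (1 / 4 + t ^ 2)) := by
  have h1 := hC t
  have hC0 : 0 ≤ C + 2 * Real.log (1 + |t|) := (norm_nonneg _).trans h1
  rw [integrand_eq, norm_mul, neg_div, norm_neg, norm_kernel hx, norm_left_den, mul_comm]
  have hre : ((((-(1 / 2) : ℝ) : ℂ) + t * I).re + 1) = 1 / 2 := by simp; norm_num
  rw [hre, Real.sqrt_eq_rpow]
  rw [show x ^ (1 / 2 : ℝ) / (1 / 4 + t ^ 2) *
      ‖deriv riemannZeta ((-(1 / 2) : ℝ) + t * I) / riemannZeta ((-(1 / 2) : ℝ) + t * I)‖ =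
      x ^ (1 / 2 : ℝ) * (‖deriv riemannZeta ((-(1 / 2) : ℝ) + t * I) /
        riemannZeta ((-(1 / 2) : ℝ) + t * I)‖ / (1 / 4 + t ^ 2)) by ring]
  exact mul_le_mul_of_nonneg_left (div_le_div_of_nonneg_right h1 (by positivity)) (by positivity)

/-- The majorant `(A + 2 log(1+|t|))/(1/4 + t²)` is integrable (`log u ≤ 2√u`, and
`(1 + |t|)^{−3/2}` is integrable on `ℝ`). [folklore] -/
theorem integrable_left_majorant {A : ℝ} (hA : 0 ≤ A) :
    Integrable fun t : ℝ ↦ (A + 2 * Real.log (1 + |t|)) / (1 / 4 + t ^ 2) := by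
  have hint : Integrable fun t : ℝ ↦ (1 + ‖t‖) ^ (-(3 / 2 : ℝ)) :=
    integrable_one_add_norm (E := ℝ) (μ := volume) (by rw [Module.finrank_self]; norm_num)
  refine ((hint.const_mul (8 * A + 32)).mono' ?_ (ae_of_all _ fun t ↦ ?_))
  · refine Continuous.aestronglyMeasurable ?_
    refine Continuous.div (continuous_const.add (continuous_const.mul
      ((continuous_const.add continuous_abs).log fun t ↦
        (by positivity : (0 : ℝ) < 1 + |t|).ne'))) (by fun_prop)
      fun t ↦ (by positivity : (1 / 4 + t ^ 2 : ℝ) ≠ 0)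
  set u : ℝ := 1 + |t| with hu
  have hu1 : 1 ≤ u := by rw [hu]; linarith [abs_nonneg t]
  have hu0 : 0 < u := by linarith
  have hlog0 : 0 ≤ Real.log u := Real.log_nonneg hu1
  have hnum0 : 0 ≤ A + 2 * Real.log u := by positivity
  rw [Real.norm_eq_abs, abs_of_nonneg (div_nonneg hnum0 (by positivity)), Real.norm_eq_abs, ← hu]
  -- `log u ≤ 2 u^{1/2}`
  have hlog : Real.log u ≤ 2 * u ^ (1 / 2 : ℝ) := by
    have := Real.log_le_rpow_div hu0.le (by norm_num : (0 : ℝ) < 1 / 2)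
    linarith
  -- `1/4 + t² ≥ u²/8`
  have hden : u ^ 2 / 8 ≤ 1 / 4 + t ^ 2 := by
    rw [hu]; nlinarith [abs_nonneg t, sq_abs t]
  have hden0 : 0 < u ^ 2 / 8 := by positivity
  -- powers of `u`
  have hu2 : u ^ 2 = u ^ (2 : ℝ) := by norm_cast
  have e1 : u ^ (1 / 2 : ℝ) / u ^ (2 : ℝ) = u ^ (-(3 / 2 : ℝ)) := by
    rw [← Real.rpow_sub hu0]; norm_num
  have e2 : 1 / u ^ (2 : ℝ) ≤ u ^ (-(3 / 2 : ℝ)) := by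
    rw [Real.rpow_neg hu0.le, one_div]
    exact inv_anti₀ (by positivity) (Real.rpow_le_rpow_of_exponent_le hu1 (by norm_num))
  have hpos : 0 < u ^ (2 : ℝ) := by positivity
  calc (A + 2 * Real.log u) / (1 / 4 + t ^ 2) ≤ (A + 2 * (2 * u ^ (1 / 2 : ℝ))) / (u ^ 2 / 8) := by
        refine div_le_div₀ (by positivity) (by linarith) hden0 hden
    _ = 8 * A * (1 / u ^ (2 : ℝ)) + 32 * (u ^ (1 / 2 : ℝ) / u ^ (2 : ℝ)) := by
        rw [hu2]; field_simp; ring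
    _ ≤ 8 * A * u ^ (-(3 / 2 : ℝ)) + 32 * u ^ (-(3 / 2 : ℝ)) := by
        rw [e1]; gcongr
    _ = (8 * A + 32) * u ^ (-(3 / 2 : ℝ)) := by ring

/-- The left-line integrand `t ↦ G_x(−1/2 + it)` is integrable on `ℝ` (`x > 0`). [folklore] -/
theorem integrable_integrand_left {x : ℝ} (hx : 0 < x) :
    Integrable fun t : ℝ ↦ integrand x (((-(1 / 2) : ℝ) : ℂ) + t * I) := by
  obtain ⟨C, hC0, hC⟩ := exists_norm_logDeriv_riemannZeta_left_le
  refine ((integrable_left_majorant hC0.le).const_mul (Real.sqrt x)).mono' ?_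
    (ae_of_all _ fun t ↦ norm_integrand_left_le hC hx t)
  refine (continuous_iff_continuousAt.2 fun t ↦ ?_).aestronglyMeasurable
  have h : ContinuousAt (integrand x) ((((-(1 / 2) : ℝ) : ℂ) + t * I)) := by
    refine continuousAt_integrand hx (riemannZeta_left_ne_zero t) ?_ ?_ ?_ <;>
      · intro h; have := congrArg Complex.re h; norm_num at this
  exact h.comp (f := fun t : ℝ ↦ (((-(1 / 2) : ℝ) : ℂ) + t * I)) (Continuous.continuousAt (by fun_prop))

end PsiOneExplicit

open PsiOneExplicit

/-- **The remainder `E(x)`** of the explicit formula for `ψ₁`: the absolutely convergent line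
integral `E(x) = (1/2πi) ∫_{(−1/2)} x^{s+1} (−ζ'/ζ(s)) ds/(s(s+1))
= (1/2π) ∫_ℝ G_x(−1/2 + it) dt`. (By MV §12.1.1 Exercise 6 it equals
`(ζ'/ζ)(−1) − ∑_{k≥1} x^{1−2k}/(2k(2k−1))`; we only use `E(x) = O(√x)`.)
[cite: MontgomeryVaughan2007, (13.7)] -/
def psiOneRemainder (x : ℝ) : ℂ :=
  (1 / (2 * π) : ℂ) * ∫ t : ℝ, integrand x (((-(1 / 2) : ℝ) : ℂ) + t * I)

namespace PsiOneExplicit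

/-! ### Absolute convergence of the sum over the zeros -/

/-- `‖k_x(ρ)‖ ≤ x²/(2δ²(1 + γ²))` at a non-trivial zero, with the gap `2δ ≤ |γ|` (`0 < δ ≤ 1/2`,
`x ≥ 1`). [folklore] -/
theorem norm_kernel_le_of_gap {δ : ℝ} (hδ : 0 < δ) (hδ2 : δ ≤ 1 / 2) {x : ℝ} (hx : 1 ≤ x) {ρ : ℂ}
    (hρ : ρ ∈ RHWave0.riemannZetaNontrivialZeros) (hgap : 2 * δ ≤ |ρ.im|) :
    ‖kernel x ρ‖ ≤ x ^ 2 / (2 * δ ^ 2) / (1 + ρ.im ^ 2) := by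
  have hx0 : 0 < x := by linarith
  rw [norm_kernel hx0, div_div]
  have him2 : 4 * δ ^ 2 ≤ ρ.im ^ 2 := by nlinarith [abs_nonneg ρ.im, sq_abs ρ.im]
  have h4 : 4 * δ ^ 2 ≤ 1 := by nlinarith
  have hn1 : |ρ.im| ≤ ‖ρ‖ := Complex.abs_im_le_norm ρ
  have hn2 : |ρ.im| ≤ ‖ρ + 1‖ := by have := Complex.abs_im_le_norm (ρ + 1); simpa using this
  have hprod : ρ.im ^ 2 ≤ ‖ρ‖ * ‖ρ + 1‖ := by
    rw [← sq_abs, sq]; exact mul_le_mul hn1 hn2 (abs_nonneg _) (norm_nonneg _)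
  have hlow : 2 * δ ^ 2 * (1 + ρ.im ^ 2) ≤ ‖ρ‖ * ‖ρ + 1‖ := by nlinarith
  have hre1 := ZetaZeros.riemannZetaNontrivialZeros.re_lt_one hρ
  have hnum : x ^ (ρ.re + 1) ≤ x ^ 2 := by
    rw [show (x ^ 2 : ℝ) = x ^ (2 : ℝ) by norm_cast]
    exact Real.rpow_le_rpow_of_exponent_le hx (by linarith)
  exact div_le_div₀ (by positivity) hnum (by positivity) hlow

/-- **Absolute convergence**: `∑_ρ ‖m(ρ) k_x(ρ)‖ < ∞` (`x ≥ 1`). [cite: MontgomeryVaughan2007, §13.1 (13.7)] -/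
theorem summable_norm_zeroOrder_mul_kernel {x : ℝ} (hx : 1 ≤ x) :
    Summable fun ρ : RHWave0.riemannZetaNontrivialZeros ↦
      ‖(riemannZetaZeroOrder (ρ : ℂ) : ℂ) * kernel x ρ‖ := by
  obtain ⟨δ, hδ, hδ2, hgap⟩ := ZetaZeroSum.exists_gap_im
  refine Summable.of_nonneg_of_le (fun _ ↦ norm_nonneg _) (fun ρ ↦ ?_)
    (ZetaZeroSum.summable_zeroOrder_div_one_add_sq.mul_left (x ^ 2 / (2 * δ ^ 2)))
  have hm := ZetaZeroSum.zeroOrder_nonneg ρ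
  rw [norm_mul, Complex.norm_intCast, abs_of_nonneg hm]
  calc (riemannZetaZeroOrder (ρ : ℂ) : ℝ) * ‖kernel x ρ‖
      ≤ (riemannZetaZeroOrder (ρ : ℂ) : ℝ) * (x ^ 2 / (2 * δ ^ 2) / (1 + (ρ : ℂ).im ^ 2)) :=
        mul_le_mul_of_nonneg_left (norm_kernel_le_of_gap hδ hδ2 hx ρ.2 (hgap _ ρ.2)) hm
    _ = x ^ 2 / (2 * δ ^ 2) * ((riemannZetaZeroOrder (ρ : ℂ) : ℝ) / (1 + (ρ : ℂ).im ^ 2)) := by ring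

/-! ### The limit along the good heights -/

/-- **The explicit formula for `ψ₁`** (`x ≥ 1`), in the namespace of the proof; see
`Literature.NumberTheory.LFunctions.psiOne_eq_explicit`. [cite: MontgomeryVaughan2007, (13.7)] -/
theorem psiOne_eq_explicit' {x : ℝ} (hx : 1 ≤ x) :
    (psiOne x : ℂ) = (x : ℂ) ^ 2 / 2 -
      ∑' ρ : RHWave0.riemannZetaNontrivialZeros, (riemannZetaZeroOrder (ρ : ℂ) : ℂ) * kernel x ρ -
        x * Complex.log (2 * π) + psiOneRemainder x := by
  have hx0 : 0 < x := by linarith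
  have hsum := (summable_norm_zeroOrder_mul_kernel hx).of_norm
  set S := ∑' ρ : RHWave0.riemannZetaNontrivialZeros, (riemannZetaZeroOrder (ρ : ℂ) : ℂ) * kernel x ρ with hS
  obtain ⟨Cz, hCz0, hCz⟩ := exists_norm_logDeriv_riemannZeta_horizontal_le
  obtain ⟨A, hA0, hA⟩ := ZetaZeroSum.exists_goodHeight_log
  obtain ⟨δ, hδ, hδ2, hgap⟩ := ZetaZeroSum.exists_gap_im
  have hgh : ∀ N : ℕ, ∃ T η : ℝ, 2 ≤ N → ((N : ℝ) ≤ T ∧ T ≤ N + 1 ∧ 0 < η ∧ η ≤ 1 / 2 ∧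
      1 / η ≤ A * Real.log (N + 6) ∧ ∀ ρ ∈ RHWave0.riemannZetaNontrivialZeros, η ≤ |ρ.im - T|) := by
    intro N
    by_cases hN : 2 ≤ N
    · obtain ⟨T, h1, h2, η, h3, h4, h5, h6⟩ := hA N hN
      exact ⟨T, η, fun _ ↦ ⟨h1, h2, h3, h4, h5, h6⟩⟩
    · exact ⟨0, 0, fun h ↦ absurd h hN⟩
  choose T η hTη using hgh
  have hTtop : Tendsto T atTop atTop := by
    refine tendsto_atTop_mono' atTop ?_ tendsto_natCast_atTop_atTop
    filter_upwards [eventually_ge_atTop 2] with N hN using (hTη N hN).1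
  -- (1) the truncated zero sums
  have hpart : Tendsto (fun N : ℕ ↦ ∑ ρ ∈ weilZeroFinset (T N),
      (riemannZetaZeroOrder (ρ : ℂ) : ℂ) * kernel x ρ) atTop (𝓝 S) :=
    (hsum.hasSum.comp tendsto_weilZeroFinset).comp hTtop
  -- (2) the horizontal sides
  set hor : ℝ → ℝ → ℂ := fun t Tv ↦ ∫ σ : ℝ in (-(1 / 2) : ℝ)..(3 / 2), integrand x (σ + t * I)
    with hhor
  have hhor0 : ∀ sgn : ℝ, (sgn = 1 ∨ sgn = -1) →
      Tendsto (fun N : ℕ ↦ ∫ σ : ℝ in (-(1 / 2) : ℝ)..(3 / 2),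
        integrand x (σ + ((sgn * T N : ℝ) : ℂ) * I)) atTop (𝓝 0) := by
    intro sgn hsgn
    refine squeeze_zero_norm' ?_
      (by simpa using ((ZetaZeroSum.tendsto_log_sq_div.const_mul
        (Cz * A * x ^ (5 / 2 : ℝ) * 2))))
    filter_upwards [eventually_ge_atTop 2] with N hN
    obtain ⟨h1, h2, h3, h4, h5, h6⟩ := hTη N hN
    have hN2 : (2 : ℝ) ≤ N := by exact_mod_cast hN
    have hT2 : 2 ≤ T N := by linarith
    have ht : sgn * T N = T N ∨ sgn * T N = -T N := by
      rcases hsgn with rfl | rfl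
      · left; ring
      · right; ring
    have hsep : ∀ ρ ∈ RHWave0.riemannZetaNontrivialZeros, η N ≤ |ρ.im - sgn * T N| := by
      rcases ht with ht | ht <;> rw [ht]
      · exact h6
      · intro ρ hρ
        have h := h6 _ (ZetaZeros.riemannZetaNontrivialZeros.conj_mem hρ)
        rw [conj_im] at h
        rwa [show |ρ.im - -T N| = |-ρ.im - T N| by
          rw [show -ρ.im - T N = -(ρ.im - -T N) by ring, abs_neg]]
    refine (norm_integral_horizontal_le hCz hx hT2 ht h3 (by linarith) hsep).trans ?_
    -- bookkeeping: `Cz log(T+4)/η · x^{5/2}/T² · 2 ≤ (Cz A x^{5/2} 2) · log²(N+7)/N`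
    set ℓ := Real.log ((N : ℝ) + 7) with hℓ
    have hℓ1 : 1 ≤ ℓ := by
      rw [hℓ, Real.le_log_iff_exp_le (by positivity)]; linarith [Real.exp_one_lt_d9]
    have hlog4 : Real.log (T N + 4) ≤ ℓ := Real.log_le_log (by linarith) (by linarith)
    have hlog40 : 0 ≤ Real.log (T N + 4) := Real.log_nonneg (by linarith)
    have hlog6 : Real.log ((N : ℝ) + 6) ≤ ℓ := Real.log_le_log (by linarith) (by linarith)
    have h1η : 1 / η N ≤ A * ℓ := h5.trans (mul_le_mul_of_nonneg_left hlog6 hA0.le)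
    have hN0 : (0 : ℝ) < N := by linarith
    have hxp : 0 ≤ x ^ (5 / 2 : ℝ) := by positivity
    have e1 : Cz * Real.log (T N + 4) / η N ≤ Cz * A * ℓ ^ 2 := by
      calc Cz * Real.log (T N + 4) / η N = Cz * Real.log (T N + 4) * (1 / η N) := by ring
        _ ≤ Cz * ℓ * (A * ℓ) :=
            mul_le_mul (mul_le_mul_of_nonneg_left hlog4 hCz0.le) h1η (by positivity) (by positivity)
        _ = Cz * A * ℓ ^ 2 := by ring
    have e2 : x ^ (5 / 2 : ℝ) / T N ^ 2 ≤ x ^ (5 / 2 : ℝ) / N :=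
      div_le_div_of_nonneg_left hxp hN0 (by nlinarith)
    calc Cz * Real.log (T N + 4) / η N * (x ^ (5 / 2 : ℝ) / T N ^ 2) * 2
        ≤ Cz * A * ℓ ^ 2 * (x ^ (5 / 2 : ℝ) / N) * 2 := by gcongr
      _ = Cz * A * x ^ (5 / 2 : ℝ) * 2 * (ℓ ^ 2 / N) := by ring
  -- (3) the vertical sides
  have hright : Tendsto (fun N : ℕ ↦ ∫ y : ℝ in (-T N)..T N,
      integrand x (((3 / 2 : ℝ) : ℂ) + y * I)) atTop (𝓝 (2 * π * (psiOne x : ℂ))) := by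
    have hI := integrable_rieszIntegrand hx0 (σ := 3 / 2) (by norm_num)
    have h := intervalIntegral_tendsto_integral hI (tendsto_neg_atTop_atBot.comp hTtop) hTtop
    have hval : ∫ t : ℝ, (x : ℂ) ^ (1 + ((3 / 2 : ℝ) + t * I)) *
        (-deriv riemannZeta ((3 / 2 : ℝ) + t * I) / riemannZeta ((3 / 2 : ℝ) + t * I)) *
        (1 / (((3 / 2 : ℝ) + t * I) * ((3 / 2 : ℝ) + t * I + 1))) = 2 * π * (psiOne x : ℂ) := by
      have e := rieszMean_vonMangoldt_eq_integral hx0 (σ := 3 / 2) (by norm_num)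
      have hπ : (2 * π : ℂ) ≠ 0 := by simp [Real.pi_ne_zero]
      unfold psiOne
      rw [e, ← mul_assoc, mul_one_div_cancel hπ, one_mul]
    rw [hval] at h
    exact h
  have hleft : Tendsto (fun N : ℕ ↦ ∫ y : ℝ in (-T N)..T N,
      integrand x (((-(1 / 2) : ℝ) : ℂ) + y * I)) atTop (𝓝 (2 * π * psiOneRemainder x)) := by
    have h := intervalIntegral_tendsto_integral (integrable_integrand_left hx0)
      (tendsto_neg_atTop_atBot.comp hTtop) hTtop
    have hval : ∫ t : ℝ, integrand x (((-(1 / 2) : ℝ) : ℂ) + t * I) = 2 * π * psiOneRemainder x := by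
      have hπ : (2 * π : ℂ) ≠ 0 := by simp [Real.pi_ne_zero]
      rw [psiOneRemainder, ← mul_assoc, mul_one_div_cancel hπ, one_mul]
    rw [hval] at h
    exact h
  -- (4) the boundary integral along `T N` and its two limits
  have hlim1 : Tendsto (fun N : ℕ ↦
      Literature.Analysis.Complex.rectBoundaryIntegral (integrand x) (-(1 / 2)) (3 / 2) (-T N) (T N)) atTop
      (𝓝 (0 - 0 + I * (2 * π * (psiOne x : ℂ)) - I * (2 * π * psiOneRemainder x))) := by
    have hb := hhor0 (-1) (Or.inr rfl)
    have ht := hhor0 1 (Or.inl rfl)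
    simp only [neg_mul, one_mul] at hb ht
    have := ((hb.sub ht).add (hright.const_mul I)).sub (hleft.const_mul I)
    refine this.congr fun N ↦ ?_
    simp only [Literature.Analysis.Complex.rectBoundaryIntegral]
  have hid : ∀ᶠ N : ℕ in atTop,
      2 * π * I * ((x : ℂ) ^ 2 / 2 -
        ∑ ρ ∈ weilZeroFinset (T N), (riemannZetaZeroOrder (ρ : ℂ) : ℂ) * kernel x ρ -
          x * Complex.log (2 * π)) =
        Literature.Analysis.Complex.rectBoundaryIntegral (integrand x) (-(1 / 2)) (3 / 2) (-T N) (T N) := by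
    filter_upwards [eventually_ge_atTop 2] with N hN
    obtain ⟨h1, h2, h3, h4, h5, h6⟩ := hTη N hN
    have hN2 : (2 : ℝ) ≤ N := by exact_mod_cast hN
    refine (contour_identity_psiOne hx0 hδ hδ2 hgap (by linarith)
      fun ρ hρ ↦ ⟨fun h ↦ ?_, fun h ↦ ?_⟩).symm
    · have := h6 ρ hρ
      rw [h, sub_self, abs_zero] at this
      linarith
    · have := h6 _ (ZetaZeros.riemannZetaNontrivialZeros.conj_mem hρ)
      rw [conj_im, h, neg_neg, sub_self, abs_zero] at this
      linarith
  have hlim2 : Tendsto (fun N : ℕ ↦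
      2 * π * I * ((x : ℂ) ^ 2 / 2 -
        ∑ ρ ∈ weilZeroFinset (T N), (riemannZetaZeroOrder (ρ : ℂ) : ℂ) * kernel x ρ -
          x * Complex.log (2 * π))) atTop
      (𝓝 (2 * π * I * ((x : ℂ) ^ 2 / 2 - S - x * Complex.log (2 * π)))) :=
    ((tendsto_const_nhds.sub hpart).sub tendsto_const_nhds).const_mul _
  have heq := tendsto_nhds_unique hlim2 (hlim1.congr' (hid.mono fun N h ↦ h.symm))
  have hπ : (2 * π * I : ℂ) ≠ 0 := by simp [Real.pi_ne_zero]
  have key : 2 * π * I * ((psiOne x : ℂ) - psiOneRemainder x) =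
      2 * π * I * ((x : ℂ) ^ 2 / 2 - S - x * Complex.log (2 * π)) := by
    rw [heq]; ring
  have := mul_left_cancel₀ hπ key
  linear_combination this

/-- `k_x(ρ) = x^{ρ+1}/(ρ(ρ+1))`, unfolded. [folklore] -/
theorem kernel_apply (x : ℝ) (ρ : ℂ) : kernel x ρ = (x : ℂ) ^ (ρ + 1) / (ρ * (ρ + 1)) := rfl

/-- The bound for `E(x)`: `‖E(x)‖ ≤ (1/2π) √x ∫ (C + 2 log(1+|t|))/(1/4+t²) dt`. [folklore] -/
theorem norm_psiOneRemainder_le {C : ℝ} (hC0 : 0 ≤ C)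
    (hC : ∀ t : ℝ, ‖deriv riemannZeta ((-(1 / 2) : ℝ) + t * I) /
      riemannZeta ((-(1 / 2) : ℝ) + t * I)‖ ≤ C + 2 * Real.log (1 + |t|))
    {x : ℝ} (hx : 0 < x) :
    ‖psiOneRemainder x‖ ≤ 1 / (2 * π) *
      (Real.sqrt x * ∫ t : ℝ, (C + 2 * Real.log (1 + |t|)) / (1 / 4 + t ^ 2)) := by
  rw [psiOneRemainder, norm_mul]
  have hn : ‖(1 / (2 * π) : ℂ)‖ = 1 / (2 * π) := by
    rw [show (1 / (2 * π) : ℂ) = ((1 / (2 * π) : ℝ) : ℂ) by push_cast; ring, Complex.norm_real,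
      Real.norm_eq_abs, abs_of_pos (by positivity)]
  rw [hn]
  refine mul_le_mul_of_nonneg_left ?_ (by positivity)
  rw [← MeasureTheory.integral_const_mul]
  have hpt : ∀ t : ℝ, ‖integrand x (((-(1 / 2) : ℝ) : ℂ) + t * I)‖ ≤
      Real.sqrt x * ((C + 2 * Real.log (1 + |t|)) / (1 / 4 + t ^ 2)) :=
    fun t ↦ norm_integrand_left_le hC hx t
  exact (MeasureTheory.norm_integral_le_integral_norm _).trans (integral_mono_of_nonneg
    (ae_of_all _ fun t ↦ norm_nonneg _) ((integrable_left_majorant hC0).const_mul _)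
    (ae_of_all _ hpt))

end PsiOneExplicit

/-! ## Main results -/

/-- **Absolute convergence of the zero sum** `∑_ρ m(ρ) x^{ρ+1}/(ρ(ρ+1))` over the non-trivial
zeros of `ζ` (`x ≥ 1`; unconditional). [cite: MontgomeryVaughan2007, §13.1 (13.7)] -/
theorem summable_norm_psiOne_zeroTerm {x : ℝ} (hx : 1 ≤ x) :
    Summable fun ρ : RHWave0.riemannZetaNontrivialZeros ↦
      ‖(riemannZetaZeroOrder (ρ : ℂ) : ℂ) * ((x : ℂ) ^ ((ρ : ℂ) + 1) / ((ρ : ℂ) * (ρ + 1)))‖ :=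
  PsiOneExplicit.summable_norm_zeroOrder_mul_kernel hx

/-- **The explicit formula for `ψ₁`** (de la Vallée Poussin 1896; Montgomery–Vaughan (13.7) with the
remainder written as the line integral `E(x)` on `Re s = −1/2`): for `x ≥ 1`,
`ψ₁(x) = x²/2 − ∑_ρ m(ρ) x^{ρ+1}/(ρ(ρ+1)) − (log 2π) x + E(x)`, the sum over the non-trivial zeros
of `ζ` (with multiplicity, absolutely convergent, `summable_norm_psiOne_zeroTerm`), and
`E = psiOneRemainder`, `‖E(x)‖ ≤ C√x` (`exists_norm_psiOneRemainder_le`).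
[cite: MontgomeryVaughan2007, (13.7); §12.1.1 Exercise 6] -/
theorem psiOne_eq_explicit {x : ℝ} (hx : 1 ≤ x) :
    (psiOne x : ℂ) = (x : ℂ) ^ 2 / 2 -
      ∑' ρ : RHWave0.riemannZetaNontrivialZeros,
        (riemannZetaZeroOrder (ρ : ℂ) : ℂ) * ((x : ℂ) ^ ((ρ : ℂ) + 1) / ((ρ : ℂ) * (ρ + 1))) -
        x * Complex.log (2 * π) + psiOneRemainder x :=
  PsiOneExplicit.psiOne_eq_explicit' hx

/-- **`E(x) = O(√x)`**: there is `C > 0` with `‖E(x)‖ ≤ C √x` for all `x > 0`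
(`|ζ'/ζ(−1/2+it)| ≤ C' + 2 log(1+|t|)` against `|x^{s+1}/(s(s+1))| = √x/(¼+t²)`).
[cite: MontgomeryVaughan2007, (13.7)] -/
theorem exists_norm_psiOneRemainder_le :
    ∃ C : ℝ, 0 < C ∧ ∀ x : ℝ, 0 < x → ‖psiOneRemainder x‖ ≤ C * Real.sqrt x := by
  obtain ⟨C, hC0, hC⟩ := PsiOneExplicit.exists_norm_logDeriv_riemannZeta_left_le
  set K : ℝ := ∫ t : ℝ, (C + 2 * Real.log (1 + |t|)) / (1 / 4 + t ^ 2) with hK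
  have hK0 : 0 ≤ K := integral_nonneg fun t ↦ div_nonneg
    (by have : 0 ≤ Real.log (1 + |t|) := Real.log_nonneg (by linarith [abs_nonneg t]); positivity)
    (by positivity)
  refine ⟨1 / (2 * π) * K + 1, by positivity, fun x hx ↦ ?_⟩
  have h := PsiOneExplicit.norm_psiOneRemainder_le hC0.le hC hx
  have hs : 0 ≤ Real.sqrt x := Real.sqrt_nonneg x
  calc ‖psiOneRemainder x‖ ≤ 1 / (2 * π) * (Real.sqrt x * K) := h
    _ = (1 / (2 * π) * K) * Real.sqrt x := by ring
    _ ≤ (1 / (2 * π) * K + 1) * Real.sqrt x := by nlinarith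

/-! ### Under the Riemann hypothesis -/

/-- Under RH, `‖x^{ρ+1}/(ρ(ρ+1))‖ ≤ x^{3/2}/|ρ|²` at a non-trivial zero (`x ≥ 1`; `|ρ+1| ≥ |ρ|`).
[cite: MontgomeryVaughan2007, §13.1 (13.8)] -/
theorem norm_psiOne_zeroTerm_le_of_RH (hRH : RiemannHypothesis) {x : ℝ} (hx : 1 ≤ x) {ρ : ℂ}
    (hρ : ρ ∈ RHWave0.riemannZetaNontrivialZeros) :
    ‖(x : ℂ) ^ (ρ + 1) / (ρ * (ρ + 1))‖ ≤ x ^ (3 / 2 : ℝ) / ‖ρ‖ ^ 2 := by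
  have hx0 : 0 < x := by linarith
  have hre : ρ.re = 1 / 2 := by
    refine hRH ρ (ZetaZeros.riemannZetaNontrivialZeros.zeta_eq_zero hρ) ?_ (ZetaZeros.riemannZetaNontrivialZeros.ne_one hρ)
    rintro ⟨n, hn⟩
    have := ZetaZeros.riemannZetaNontrivialZeros.re_pos hρ
    rw [hn] at this
    simp at this
    linarith [(n.cast_nonneg : (0 : ℝ) ≤ n)]
  have hρ0 : ρ ≠ 0 := fun h ↦ by
    have := ZetaZeros.riemannZetaNontrivialZeros.re_pos hρ; rw [h] at this; simp at this
  have hn : 0 < ‖ρ‖ := norm_pos_iff.2 hρ0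
  rw [← PsiOneExplicit.kernel_apply, PsiOneExplicit.norm_kernel hx0, hre,
    show (1 / 2 + 1 : ℝ) = 3 / 2 by norm_num]
  refine div_le_div_of_nonneg_left (by positivity) (by positivity) ?_
  rw [sq]
  refine mul_le_mul_of_nonneg_left ?_ hn.le
  -- `‖ρ‖ ≤ ‖ρ + 1‖` since `Re ρ > 0`
  rw [← Real.sqrt_sq hn.le, ← Real.sqrt_sq (norm_nonneg (ρ + 1))]
  refine Real.sqrt_le_sqrt ?_
  rw [Complex.sq_norm, Complex.sq_norm, Complex.normSq_apply, Complex.normSq_apply]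
  simp only [add_re, one_re, add_im, one_im, add_zero]
  nlinarith [ZetaZeros.riemannZetaNontrivialZeros.re_pos hρ]

/-- **Under RH, `‖∑_ρ m(ρ) x^{ρ+1}/(ρ(ρ+1))‖ ≤ β x^{3/2}`** (`x ≥ 1`, `β = nicolasBeta = ∑ m(ρ)/|ρ|²`,
`ZetaZeroReciprocalSum.lean`). [cite: MontgomeryVaughan2007, §13.1 (13.8)] -/
theorem norm_psiOne_zeroSum_le_of_RH (hRH : RiemannHypothesis) {x : ℝ} (hx : 1 ≤ x) :
    ‖∑' ρ : RHWave0.riemannZetaNontrivialZeros,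
        (riemannZetaZeroOrder (ρ : ℂ) : ℂ) * ((x : ℂ) ^ ((ρ : ℂ) + 1) / ((ρ : ℂ) * (ρ + 1)))‖ ≤
      nicolasBeta * x ^ (3 / 2 : ℝ) := by
  have hS := hasSum_zeroOrder_div_norm_sq_of_RH hRH
  have hle : ∀ ρ : RHWave0.riemannZetaNontrivialZeros,
      ‖(riemannZetaZeroOrder (ρ : ℂ) : ℂ) * ((x : ℂ) ^ ((ρ : ℂ) + 1) / ((ρ : ℂ) * (ρ + 1)))‖ ≤
        x ^ (3 / 2 : ℝ) * ((riemannZetaZeroOrder (ρ : ℂ) : ℝ) / ‖(ρ : ℂ)‖ ^ 2) := by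
    intro ρ
    have hm := ZetaZeroSum.zeroOrder_nonneg ρ
    rw [norm_mul, Complex.norm_intCast, abs_of_nonneg hm]
    calc (riemannZetaZeroOrder (ρ : ℂ) : ℝ) * ‖(x : ℂ) ^ ((ρ : ℂ) + 1) / ((ρ : ℂ) * (ρ + 1))‖
        ≤ (riemannZetaZeroOrder (ρ : ℂ) : ℝ) * (x ^ (3 / 2 : ℝ) / ‖(ρ : ℂ)‖ ^ 2) :=
          mul_le_mul_of_nonneg_left (norm_psiOne_zeroTerm_le_of_RH hRH hx ρ.2) hm
      _ = _ := by ring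
  have hsum := summable_norm_psiOne_zeroTerm hx
  calc _ ≤ ∑' ρ : RHWave0.riemannZetaNontrivialZeros,
        ‖(riemannZetaZeroOrder (ρ : ℂ) : ℂ) * ((x : ℂ) ^ ((ρ : ℂ) + 1) / ((ρ : ℂ) * (ρ + 1)))‖ :=
        norm_tsum_le_tsum_norm hsum
    _ ≤ ∑' ρ : RHWave0.riemannZetaNontrivialZeros,
        x ^ (3 / 2 : ℝ) * ((riemannZetaZeroOrder (ρ : ℂ) : ℝ) / ‖(ρ : ℂ)‖ ^ 2) :=
        hsum.tsum_le_tsum hle (hS.summable.mul_left _)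
    _ = nicolasBeta * x ^ (3 / 2 : ℝ) := by rw [tsum_mul_left, hS.tsum_eq, mul_comm]

/-- **MV (13.8), explicit form**: under RH, for `x ≥ 1`,
`‖ψ₁(x) − x²/2 + (log 2π) x − E(x)‖ ≤ β x^{3/2}`. [cite: MontgomeryVaughan2007, §13.1 (13.8)] -/
theorem norm_psiOne_sub_le_of_RH (hRH : RiemannHypothesis) {x : ℝ} (hx : 1 ≤ x) :
    ‖(psiOne x : ℂ) - (x : ℂ) ^ 2 / 2 + x * Complex.log (2 * π) - psiOneRemainder x‖ ≤
      nicolasBeta * x ^ (3 / 2 : ℝ) := by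
  rw [psiOne_eq_explicit hx]
  set S := ∑' ρ : RHWave0.riemannZetaNontrivialZeros,
    (riemannZetaZeroOrder (ρ : ℂ) : ℂ) * ((x : ℂ) ^ ((ρ : ℂ) + 1) / ((ρ : ℂ) * (ρ + 1))) with hS
  have e : (x : ℂ) ^ 2 / 2 - S - x * Complex.log (2 * π) + psiOneRemainder x - (x : ℂ) ^ 2 / 2 +
      x * Complex.log (2 * π) - psiOneRemainder x = -S := by ring
  rw [e, norm_neg]
  exact norm_psiOne_zeroSum_le_of_RH hRH hx

end Literature.NumberTheory.LFunctions

end
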